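import Literature.Analysis.FluidPDE.JetStepWeighted
import Literature.Analysis.FluidPDE.JetStepTheorem
import Literature.Analysis.FunctionSpaces.TorusImprovedHolderTwoSided
import HarnessLib

/-!
# The time-weighted intermittent-jet step: fixed-time estimates and the energy identity
  (BV, Ann. of Math. 189 (2019), §7; EMS Surv. 6 (2019), §7.6–7.7)

Analysis/FluidPDE support file (everything proved): the sizes, at a fixed time, of the pieces of
the time-weighted jet perturbation `w̃ = s (w^{(p)} + w^{(c)}) + s² w^{(t)}` of `JetStepWeighted`
(weight `0 ≤ s ≤ 1`, `|s'| ≤ S'`): `L¹` and sup sizes of the new stress (the unweighted sizes of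
`JetStressEstimates` / `JetSupSummary` plus the cut-off terms `S' C₁ (L_p + L_c + 2√E_X)`, resp.
`K_ℛ S' (sup w^{(p)} + sup w^{(c)} + 2 sup X)`), `C⁰/C¹/∂ₜ` sizes of `w̃`, and the TWO-SIDED energy
identity of Buckmaster–Vicol 2019, §7 (7.3)–(7.6):
`|∫|v + w̃|² - ∫|v|² - s² ∫(3ρ - tr N)| ≤ 2V₀ ∫|w̃| + 2‖s w^{(p)}‖₂‖w̃_r‖₂ + ‖w̃_r‖₂² + 15 N H₁ √3 σ⁻¹`
(`∫|w^{(p)}|² = ∑_x |k_x|² ∫ a_x² η²ψ̃²` by disjointness of supports, and `∫ a_x² η²ψ̃² = ∫ a_x² ± 3H₁√3σ⁻¹` by the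
two-sided improved Hölder inequality at `p = 1`, `Torus.abs_integral_mul_sub_le_of_latticeInvariant`;
`∑_x |k_x|² a_x² = 3ρ - tr N` by the geometric lemma), together with `|∫(3ρ - tr N) - 6γ₀/r| ≤ (18/r + 3)∫‖N‖`.
The step theorem with symbolic parameters assembling all of this is `JetStep.jet_step_weighted`.

## References

* T. Buckmaster, V. Vicol, Ann. of Math. 189 (2019) = arXiv:1709.10033, Prop. 2.1, §7 (7.3)–(7.6). [`BuckmasterVicol2019Annals`]
* T. Buckmaster, V. Vicol, EMS Surv. Math. Sci. 6 (2019) = arXiv:1901.09023, §7.5.4 (7.40), §7.6–7.7. [`BuckmasterVicol2020`]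
-/

noncomputable section

open MeasureTheory Set Filter Topology Function
open scoped InnerProductSpace ContDiff ENNReal NNReal

namespace Literature.Analysis.FluidPDE

namespace JetStep

open Literature.Analysis.FunctionSpaces FunctionSpaces.Torus Mikado NashGeometric Jet

local notation "𝕋³" => UnitAddTorus (Fin 3)
local notation "E³" => EuclideanSpace ℝ (Fin 3)
local notation "Idx" => Index (Fin 3)

namespace Datum

variable {D : Datum} (h : D.Valid) {A₀ A₁ A₂ H₁ H₂ B Cψ : ℝ} {K K₁ : ℝ≥0} (hA : D.AmpBounds A₀ A₁ A₂ H₁ H₂)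
  (hB : ∀ x t, Jet.Bounds B (D.J x) D.s x t) (hB1 : 1 ≤ B) {s : ℝ → ℝ} (hs : ContDiffOn ℝ ∞ s (Icc 0 D.T))
include h

/-! ## The weighted correctors and the `L¹` mass of `w̃` -/

omit h in
/-- `w̃r = s (wpc - wp) + s² X + s² ∇ζ`. [folklore] -/
theorem wrW_eq {t : ℝ} (ht : t ∈ Icc 0 D.T) (y : 𝕋³) (hζ : Torus.IsSmooth (D.zeta t)) :
    D.wrW s t y = s t • (D.wpc t y - D.wp t y) + (s t) ^ 2 • D.X t y + (s t) ^ 2 • Torus.gradient (D.zeta t) y := by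
  have _ := ht
  have eg : Torus.gradient (D.zetaW s t) y = (s t) ^ 2 • Torus.gradient (D.zeta t) y := by
    rw [show D.zetaW s t = fun z => (s t) ^ 2 * D.zeta t z from rfl, Torus.gradient_const_mul_apply (hζ.isContDiff (by simp))]
  show D.wW' s t y + Torus.gradient (D.zetaW s t) y - s t • D.wp t y = _
  rw [eg, show D.wW' s t y = s t • D.wpc t y + (s t) ^ 2 • D.X t y from rfl, smul_sub]
  abel

/-- Unit weights: `|s| ≤ 1`, `s² ≤ 1`, `|s|, s² ≥ 0`. [folklore] -/
theorem weight_le_one {t : ℝ} (h01 : 0 ≤ s t ∧ s t ≤ 1) : |s t| ≤ 1 ∧ (s t) ^ 2 ≤ 1 ∧ |(s t) ^ 2| ≤ 1 := by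
  have _ := h
  obtain ⟨h0, h1⟩ := h01
  have hsq : (s t) ^ 2 ≤ 1 := by nlinarith
  exact ⟨by rw [abs_of_nonneg h0]; exact h1, hsq, by rw [abs_of_nonneg (sq_nonneg _)]; exact hsq⟩

include hs in
/-- **`∫‖w̃r‖² ≤ 3(S_c L_c + E_X + E_ζ)`** for `0 ≤ s ≤ 1`. [folklore] -/
theorem integral_norm_wrW_sq_le {t : ℝ} (ht : t ∈ Icc 0 D.T) (h01 : 0 ≤ s t ∧ s t ≤ 1) {Sc Lc EX Eζ : ℝ}
    (hSc : ∀ y, ‖D.wpc t y - D.wp t y‖ ≤ Sc) (hLc : ∫ y, ‖D.wpc t y - D.wp t y‖ ≤ Lc) (hEX : ∫ y, ‖D.X t y‖ ^ 2 ≤ EX)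
    (hEζ : ∫ y, ‖Torus.gradient (D.zeta t) y‖ ^ 2 ≤ Eζ) :
    ∫ y, ‖D.wrW s t y‖ ^ 2 ≤ 3 * (Sc * Lc + EX + Eζ) := by
  obtain ⟨hs1, hs2, -⟩ := weight_le_one h h01
  have hwc : Torus.IsSmooth (fun y => D.wpc t y - D.wp t y) := ((smooth_wpc h).isSmooth_slice ht).sub (isSmooth_wp h ht)
  have hX : Torus.IsSmooth (D.X t) := (smooth_X h).isSmooth_slice ht
  have hζs : Torus.IsSmooth (D.zeta t) := (smooth_zeta h).isSmooth_slice ht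
  have hζ : Torus.IsSmooth (Torus.gradient (D.zeta t)) := hζs.gradient
  have hpt : ∀ y, ‖D.wrW s t y‖ ^ 2 ≤ 3 * (‖D.wpc t y - D.wp t y‖ ^ 2 + ‖D.X t y‖ ^ 2 + ‖Torus.gradient (D.zeta t) y‖ ^ 2) := by
    intro y
    rw [wrW_eq ht y hζs]
    have n1 : ‖s t • (D.wpc t y - D.wp t y)‖ ≤ ‖D.wpc t y - D.wp t y‖ := by
      rw [norm_smul, Real.norm_eq_abs]; exact (mul_le_mul_of_nonneg_right hs1 (norm_nonneg _)).trans (by rw [one_mul])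
    have n2 : ‖(s t) ^ 2 • D.X t y‖ ≤ ‖D.X t y‖ := by
      rw [norm_smul, Real.norm_eq_abs, abs_of_nonneg (sq_nonneg _)]
      exact (mul_le_mul_of_nonneg_right hs2 (norm_nonneg _)).trans (by rw [one_mul])
    have n3 : ‖(s t) ^ 2 • Torus.gradient (D.zeta t) y‖ ≤ ‖Torus.gradient (D.zeta t) y‖ := by
      rw [norm_smul, Real.norm_eq_abs, abs_of_nonneg (sq_nonneg _)]
      exact (mul_le_mul_of_nonneg_right hs2 (norm_nonneg _)).trans (by rw [one_mul])
    have h1 := norm_add_le (s t • (D.wpc t y - D.wp t y) + (s t) ^ 2 • D.X t y) ((s t) ^ 2 • Torus.gradient (D.zeta t) y)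
    have h2 := norm_add_le (s t • (D.wpc t y - D.wp t y)) ((s t) ^ 2 • D.X t y)
    have hle : ‖s t • (D.wpc t y - D.wp t y) + (s t) ^ 2 • D.X t y + (s t) ^ 2 • Torus.gradient (D.zeta t) y‖ ≤
        ‖D.wpc t y - D.wp t y‖ + ‖D.X t y‖ + ‖Torus.gradient (D.zeta t) y‖ := by linarith
    have h0 : 0 ≤ ‖s t • (D.wpc t y - D.wp t y) + (s t) ^ 2 • D.X t y + (s t) ^ 2 • Torus.gradient (D.zeta t) y‖ := norm_nonneg _
    calc ‖s t • (D.wpc t y - D.wp t y) + (s t) ^ 2 • D.X t y + (s t) ^ 2 • Torus.gradient (D.zeta t) y‖ ^ 2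
        ≤ (‖D.wpc t y - D.wp t y‖ + ‖D.X t y‖ + ‖Torus.gradient (D.zeta t) y‖) ^ 2 := pow_le_pow_left₀ h0 hle 2
      _ ≤ 3 * (‖D.wpc t y - D.wp t y‖ ^ 2 + ‖D.X t y‖ ^ 2 + ‖Torus.gradient (D.zeta t) y‖ ^ 2) := by
          nlinarith [sq_nonneg (‖D.wpc t y - D.wp t y‖ - ‖D.X t y‖), sq_nonneg (‖D.X t y‖ - ‖Torus.gradient (D.zeta t) y‖),
            sq_nonneg (‖D.wpc t y - D.wp t y‖ - ‖Torus.gradient (D.zeta t) y‖)]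
  have hSc0 : 0 ≤ Sc := (norm_nonneg _).trans (hSc (Classical.arbitrary _))
  have hwc2 : ∫ y, ‖D.wpc t y - D.wp t y‖ ^ 2 ≤ Sc * Lc := by
    calc ∫ y, ‖D.wpc t y - D.wp t y‖ ^ 2 ≤ ∫ y, Sc * ‖D.wpc t y - D.wp t y‖ :=
          integral_mono (hwc.continuous.norm.pow 2).integrable_unitAddTorus (hwc.continuous.norm.const_mul _).integrable_unitAddTorus fun y => by
            rw [sq]; exact mul_le_mul_of_nonneg_right (hSc y) (norm_nonneg _)
      _ ≤ Sc * Lc := by rw [integral_const_mul]; exact mul_le_mul_of_nonneg_left hLc hSc0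
  have c1 : Integrable (fun y => ‖D.wpc t y - D.wp t y‖ ^ 2) volume := (hwc.continuous.norm.pow 2).integrable_unitAddTorus
  have c2 : Integrable (fun y => ‖D.X t y‖ ^ 2) volume := (hX.continuous.norm.pow 2).integrable_unitAddTorus
  have c3 : Integrable (fun y => ‖Torus.gradient (D.zeta t) y‖ ^ 2) volume := (hζ.continuous.norm.pow 2).integrable_unitAddTorus
  have c12 : Integrable (fun y => ‖D.wpc t y - D.wp t y‖ ^ 2 + ‖D.X t y‖ ^ 2) volume := c1.add c2
  have c123 : Integrable (fun y => ‖D.wpc t y - D.wp t y‖ ^ 2 + ‖D.X t y‖ ^ 2 + ‖Torus.gradient (D.zeta t) y‖ ^ 2) volume := c12.add c3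
  calc ∫ y, ‖D.wrW s t y‖ ^ 2 ≤ ∫ y, 3 * (‖D.wpc t y - D.wp t y‖ ^ 2 + ‖D.X t y‖ ^ 2 + ‖Torus.gradient (D.zeta t) y‖ ^ 2) :=
        integral_mono (((smooth_wrW h hs).isSmooth_slice ht).continuous.norm.pow 2).integrable_unitAddTorus (c123.const_mul 3) hpt
    _ = 3 * ((∫ y, ‖D.wpc t y - D.wp t y‖ ^ 2) + (∫ y, ‖D.X t y‖ ^ 2) + ∫ y, ‖Torus.gradient (D.zeta t) y‖ ^ 2) := by
        rw [integral_const_mul, integral_add c12 c3, integral_add c1 c2]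
    _ ≤ 3 * (Sc * Lc + EX + Eζ) := by gcongr

include hs in
/-- **`∫‖w̃‖ ≤ L_p + L_c + √E_X + √E_ζ`** for `0 ≤ s ≤ 1`. [folklore] -/
theorem integral_norm_wW_le {t : ℝ} (ht : t ∈ Icc 0 D.T) (h01 : 0 ≤ s t ∧ s t ≤ 1) {Lp Lc EX Eζ : ℝ}
    (hLp : ∫ y, ‖D.wp t y‖ ≤ Lp) (hLc : ∫ y, ‖D.wpc t y - D.wp t y‖ ≤ Lc) (hEX : ∫ y, ‖D.X t y‖ ^ 2 ≤ EX)
    (hEζ : ∫ y, ‖Torus.gradient (D.zeta t) y‖ ^ 2 ≤ Eζ) :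
    ∫ y, ‖D.wW s t y‖ ≤ Lp + Lc + Real.sqrt EX + Real.sqrt Eζ := by
  obtain ⟨hs1, hs2, -⟩ := weight_le_one h h01
  have hwp := isSmooth_wp h ht
  have hwc : Torus.IsSmooth (fun y => D.wpc t y - D.wp t y) := ((smooth_wpc h).isSmooth_slice ht).sub hwp
  have hX : Torus.IsSmooth (D.X t) := (smooth_X h).isSmooth_slice ht
  have hζs : Torus.IsSmooth (D.zeta t) := (smooth_zeta h).isSmooth_slice ht
  have hζ : Torus.IsSmooth (Torus.gradient (D.zeta t)) := hζs.gradient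
  have hw : Torus.IsSmooth (D.wW s t) := (smooth_wW h hs).isSmooth_slice ht
  have hw4 : ∀ y, ‖D.wW s t y‖ ≤ ‖D.wp t y‖ + ‖D.wpc t y - D.wp t y‖ + ‖D.X t y‖ + ‖Torus.gradient (D.zeta t) y‖ := by
    intro y
    have e : D.wW s t y = s t • D.wp t y + (s t • (D.wpc t y - D.wp t y) + (s t) ^ 2 • D.X t y + (s t) ^ 2 • Torus.gradient (D.zeta t) y) := by
      rw [← wrW_eq ht y hζs]; simp [wrW]
    rw [e]
    have n0 : ‖s t • D.wp t y‖ ≤ ‖D.wp t y‖ := by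
      rw [norm_smul, Real.norm_eq_abs]; exact (mul_le_mul_of_nonneg_right hs1 (norm_nonneg _)).trans (by rw [one_mul])
    have n1 : ‖s t • (D.wpc t y - D.wp t y)‖ ≤ ‖D.wpc t y - D.wp t y‖ := by
      rw [norm_smul, Real.norm_eq_abs]; exact (mul_le_mul_of_nonneg_right hs1 (norm_nonneg _)).trans (by rw [one_mul])
    have n2 : ‖(s t) ^ 2 • D.X t y‖ ≤ ‖D.X t y‖ := by
      rw [norm_smul, Real.norm_eq_abs, abs_of_nonneg (sq_nonneg _)]
      exact (mul_le_mul_of_nonneg_right hs2 (norm_nonneg _)).trans (by rw [one_mul])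
    have n3 : ‖(s t) ^ 2 • Torus.gradient (D.zeta t) y‖ ≤ ‖Torus.gradient (D.zeta t) y‖ := by
      rw [norm_smul, Real.norm_eq_abs, abs_of_nonneg (sq_nonneg _)]
      exact (mul_le_mul_of_nonneg_right hs2 (norm_nonneg _)).trans (by rw [one_mul])
    have := norm_add_le (s t • D.wp t y) (s t • (D.wpc t y - D.wp t y) + (s t) ^ 2 • D.X t y + (s t) ^ 2 • Torus.gradient (D.zeta t) y)
    have := norm_add_le (s t • (D.wpc t y - D.wp t y) + (s t) ^ 2 • D.X t y) ((s t) ^ 2 • Torus.gradient (D.zeta t) y)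
    have := norm_add_le (s t • (D.wpc t y - D.wp t y)) ((s t) ^ 2 • D.X t y)
    linarith
  have c1 : Continuous fun y => ‖D.wp t y‖ := hwp.continuous.norm
  have c2 : Continuous fun y => ‖D.wpc t y - D.wp t y‖ := hwc.continuous.norm
  have c3 : Continuous fun y => ‖D.X t y‖ := hX.continuous.norm
  have c4 : Continuous fun y => ‖Torus.gradient (D.zeta t) y‖ := hζ.continuous.norm
  have j12 : Integrable (fun y => ‖D.wp t y‖ + ‖D.wpc t y - D.wp t y‖) volume := (c1.add c2).integrable_unitAddTorus
  have j123 : Integrable (fun y => ‖D.wp t y‖ + ‖D.wpc t y - D.wp t y‖ + ‖D.X t y‖) volume := ((c1.add c2).add c3).integrable_unitAddTorus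
  have j1234 : Integrable (fun y => ‖D.wp t y‖ + ‖D.wpc t y - D.wp t y‖ + ‖D.X t y‖ + ‖Torus.gradient (D.zeta t) y‖) volume :=
    (((c1.add c2).add c3).add c4).integrable_unitAddTorus
  calc ∫ y, ‖D.wW s t y‖ ≤ ∫ y, (‖D.wp t y‖ + ‖D.wpc t y - D.wp t y‖ + ‖D.X t y‖ + ‖Torus.gradient (D.zeta t) y‖) :=
        integral_mono hw.continuous.norm.integrable_unitAddTorus j1234 hw4
    _ = (∫ y, ‖D.wp t y‖) + (∫ y, ‖D.wpc t y - D.wp t y‖) + (∫ y, ‖D.X t y‖) + ∫ y, ‖Torus.gradient (D.zeta t) y‖ := by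
        rw [integral_add j123 c4.integrable_unitAddTorus, integral_add j12 c3.integrable_unitAddTorus,
          integral_add c1.integrable_unitAddTorus c2.integrable_unitAddTorus]
    _ ≤ Lp + Lc + Real.sqrt EX + Real.sqrt Eζ :=
        add_le_add (add_le_add (add_le_add hLp hLc) (integral_norm_le_sqrt hX.continuous hEX)) (integral_norm_le_sqrt hζ.continuous hEζ)

include hs in
/-- **`∫‖crossW‖ ≤ 2√(E_p E_r) + E_r`** with `E_p ≥ ∫‖wp‖²`, `E_r ≥ ∫‖w̃r‖²`, `0 ≤ s ≤ 1`. [cite: BuckmasterVicol2020, §7.6.3 (7.54)] -/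
theorem integral_norm_crossW_le {t : ℝ} (ht : t ∈ Icc 0 D.T) (h01 : 0 ≤ s t ∧ s t ≤ 1) {Ep Er : ℝ}
    (hEp : ∫ y, ‖D.wp t y‖ ^ 2 ≤ Ep) (hEr : ∫ y, ‖D.wrW s t y‖ ^ 2 ≤ Er) :
    ∫ y, ‖D.crossW s t y‖ ≤ 2 * (Real.sqrt Ep * Real.sqrt Er) + Er := by
  obtain ⟨hs1, -, -⟩ := weight_le_one h h01
  have hwp := isSmooth_wp h ht
  have hswp := isSmooth_swp h hs ht
  have hwr := isSmooth_wrW h hs ht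
  have hEp' : ∫ y, ‖s t • D.wp t y‖ ^ 2 ≤ Ep := by
    refine le_trans (integral_mono (hswp.continuous.norm.pow 2).integrable_unitAddTorus (hwp.continuous.norm.pow 2).integrable_unitAddTorus
      fun y => ?_) hEp
    have : ‖s t • D.wp t y‖ ≤ ‖D.wp t y‖ := by
      rw [norm_smul, Real.norm_eq_abs]; exact (mul_le_mul_of_nonneg_right hs1 (norm_nonneg _)).trans (by rw [one_mul])
    exact pow_le_pow_left₀ (norm_nonneg _) this 2
  have hpt : ∀ y, ‖D.crossW s t y‖ ≤ 2 * (‖s t • D.wp t y‖ * ‖D.wrW s t y‖) + ‖D.wrW s t y‖ * ‖D.wrW s t y‖ := by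
    intro y
    have e : D.crossW s t y = Torus.tensorProd (fun z => s t • D.wp t z) (D.wrW s t) y + Torus.tensorProd (D.wrW s t) (fun z => s t • D.wp t z) y +
        Torus.tensorProd (D.wrW s t) (D.wrW s t) y := by
      funext j; rfl
    rw [e]
    calc _ ≤ ‖Torus.tensorProd (fun z => s t • D.wp t z) (D.wrW s t) y‖ + ‖Torus.tensorProd (D.wrW s t) (fun z => s t • D.wp t z) y‖ +
          ‖Torus.tensorProd (D.wrW s t) (D.wrW s t) y‖ := (norm_add_le _ _).trans (add_le_add (norm_add_le _ _) le_rfl)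
      _ ≤ ‖s t • D.wp t y‖ * ‖D.wrW s t y‖ + ‖D.wrW s t y‖ * ‖s t • D.wp t y‖ + ‖D.wrW s t y‖ * ‖D.wrW s t y‖ :=
          add_le_add (add_le_add (norm_tensorProd_le _ _ y) (norm_tensorProd_le _ _ y)) (norm_tensorProd_le _ _ y)
      _ = _ := by ring
  have c1 : Continuous fun y => ‖s t • D.wp t y‖ * ‖D.wrW s t y‖ := hswp.continuous.norm.mul hwr.continuous.norm
  have c2 : Continuous fun y => ‖D.wrW s t y‖ * ‖D.wrW s t y‖ := hwr.continuous.norm.mul hwr.continuous.norm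
  have i1 : Integrable (fun y => 2 * (‖s t • D.wp t y‖ * ‖D.wrW s t y‖)) volume := (c1.const_mul 2).integrable_unitAddTorus
  have i2 : Integrable (fun y => ‖D.wrW s t y‖ * ‖D.wrW s t y‖) volume := c2.integrable_unitAddTorus
  have i12 : Integrable (fun y => 2 * (‖s t • D.wp t y‖ * ‖D.wrW s t y‖) + ‖D.wrW s t y‖ * ‖D.wrW s t y‖) volume := i1.add i2
  calc ∫ y, ‖D.crossW s t y‖ ≤ ∫ y, (2 * (‖s t • D.wp t y‖ * ‖D.wrW s t y‖) + ‖D.wrW s t y‖ * ‖D.wrW s t y‖) :=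
        integral_mono (isSmooth_crossW h hs ht).continuous.norm.integrable_unitAddTorus i12 hpt
    _ = 2 * (∫ y, ‖s t • D.wp t y‖ * ‖D.wrW s t y‖) + ∫ y, ‖D.wrW s t y‖ * ‖D.wrW s t y‖ := by
        rw [integral_add i1 i2, integral_const_mul]
    _ ≤ 2 * (Real.sqrt Ep * Real.sqrt Er) + Er := by
        refine add_le_add (mul_le_mul_of_nonneg_left (integral_norm_mul_norm_le hswp.continuous hwr.continuous hEp' hEr) (by norm_num)) ?_
        refine le_trans (le_of_eq (integral_congr_ae (Eventually.of_forall fun y => ?_))) hEr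
        show ‖D.wrW s t y‖ * ‖D.wrW s t y‖ = ‖D.wrW s t y‖ ^ 2; ring

/-! ## The `L¹` size of the new stress -/

include hs in
/-- **The `L¹` size of the weighted new stress at time `t`**, from the sizes of the pieces: the
unweighted sizes plus the cut-off terms `S' C₁ (L_p + L_c + 2√E_X)`.
[cite: BuckmasterVicol2019Annals, §7; BuckmasterVicol2020, §7.6.2 (7.48)–(7.53)] -/
theorem integral_norm_newStressW_le {ν : ℝ} {v : ℝ → 𝕋³ → E³} {Rc : ℝ → 𝕋³ → Fin 3 → E³}
    (hRc : Torus.IsSmoothSpaceTimeOn (Icc 0 D.T) Rc) {t : ℝ} (ht : t ∈ Icc 0 D.T) (hvc : Continuous (v t))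
    (h01 : 0 ≤ s t ∧ s t ≤ 1) {S' : ℝ} (hS' : |D.sdot s t| ≤ S')
    {V₀ ρc Ep Sc Lc EX Eζ Lp LdW LdX LS Lf₂ Lf₃ Lf₁ : ℝ} {C₁ : ℝ≥0}
    (hV : ∀ y, ‖v t y‖ ≤ V₀) (hρ : ∀ y, ‖Rc t y‖ ≤ ρc)
    (hEp : ∫ y, ‖D.wp t y‖ ^ 2 ≤ Ep) (hLp : ∫ y, ‖D.wp t y‖ ≤ Lp)
    (hSc : ∀ y, ‖D.wpc t y - D.wp t y‖ ≤ Sc) (hLc : ∫ y, ‖D.wpc t y - D.wp t y‖ ≤ Lc)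
    (hEX : ∫ y, ‖D.X t y‖ ^ 2 ≤ EX) (hEζ : ∫ y, ‖Torus.gradient (D.zeta t) y‖ ^ 2 ≤ Eζ)
    (hdW : ∀ i, ∫ y, ‖Torus.partialDeriv i (D.wpc t) y‖ ≤ LdW) (hdX : ∀ i, ∫ y, ‖Torus.partialDeriv i (D.X t) y‖ ≤ LdX)
    (hS : ∫ y, ‖D.Sosc t y‖ ≤ LS) (hf₂ : ∫ y, ‖D.f₂ t y‖ ≤ Lf₂) (hf₃ : ∫ y, ‖D.f₃ t y‖ ≤ Lf₃)
    (hf₁ : ∫ y, ‖Torus.antidivergence (D.f₁ t) y‖ ≤ Lf₁)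
    (hC₁ : ∀ g : 𝕋³ → E³, Torus.IsSmooth g → eLpNorm (Torus.antidivergence g) 1 volume ≤ C₁ * eLpNorm g 1 volume) :
    ∫ y, ‖Torus.perturbedStressV ν v (D.wW' s) (D.zetaW s) (D.S₁W s Rc) (D.ffunW s) t y‖ ≤
      2 * (ρc + (2 * (Real.sqrt Ep * Real.sqrt (3 * (Sc * Lc + EX + Eζ))) + 3 * (Sc * Lc + EX + Eζ)) + LS) +
      4 * V₀ * (Lp + Lc + Real.sqrt EX + Real.sqrt Eζ) + 4 * |ν| * (3 * (LdW + LdX)) +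
      (Lf₁ + (C₁ : ℝ) * (2 * (Lf₂ + Lf₃) + S' * (Lp + Lc + 2 * Real.sqrt EX))) := by
  have hU := uniqueDiffOn h
  obtain ⟨hs1, hs2, hs2'⟩ := weight_le_one h h01
  have hS'0 : 0 ≤ S' := (abs_nonneg _).trans hS'
  -- smoothness at time `t`
  have hw' : Torus.IsSmooth (D.wW' s t) := (smooth_wW' h hs).isSmooth_slice ht
  have hw : Torus.IsSmooth (D.wW s t) := (smooth_wW h hs).isSmooth_slice ht
  have hwpc : Torus.IsSmooth (D.wpc t) := (smooth_wpc h).isSmooth_slice ht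
  have hwp := isSmooth_wp h ht
  have hX : Torus.IsSmooth (D.X t) := (smooth_X h).isSmooth_slice ht
  have hS₁ : Torus.IsSmooth (D.S₁W s Rc t) := (smooth_S₁W h hs hRc).isSmooth_slice ht
  have hf1 : Torus.IsSmooth (D.f₁ t) := (smooth_f₁ h).isSmooth_slice ht
  have hsf1 : Torus.IsSmooth (fun y => s t • D.f₁ t y) := hf1.smul (s t)
  have hf2 : Torus.IsSmooth (D.f₂ t) := (smooth_f₂ h).isSmooth_slice ht
  have hf3 : Torus.IsSmooth (D.f₃ t) := (smooth_f₃ h).isSmooth_slice ht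
  have hg0 : Torus.IsSmooth (fun y => D.f₂ t y + D.f₃ t y + D.f₄ t) := (hf2.add hf3).add (Torus.isSmooth_const _)
  have hg : Torus.IsSmooth (fun y => (s t) ^ 2 • (D.f₂ t y + D.f₃ t y + D.f₄ t) + D.sdot s t • D.wpc t y + (2 * s t * D.sdot s t) • D.X t y) :=
    ((hg0.smul ((s t) ^ 2)).add (hwpc.smul _)).add (hX.smul _)
  have hff : Torus.IsSmooth (D.ffunW s t) := (smooth_ffunW h hs).isSmooth_slice ht
  have hAf : Torus.IsSmooth (Torus.antidivergence (D.ffunW s t)) := Torus.isSmooth_antidivergence hff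
  -- nonnegativity of the sizes
  have hV0 : 0 ≤ V₀ := (norm_nonneg _).trans (hV (Classical.arbitrary _))
  -- the pointwise bound
  have hpt : ∀ y, ‖Torus.perturbedStressV ν v (D.wW' s) (D.zetaW s) (D.S₁W s Rc) (D.ffunW s) t y‖ ≤
      2 * ‖D.S₁W s Rc t y‖ + 4 * (‖v t y‖ * ‖D.wW s t y‖) + 4 * |ν| * ∑ i, ‖Torus.partialDeriv i (D.wW' s t) y‖ +
        ‖Torus.antidivergence (D.ffunW s t) y‖ := by
    intro y
    have := Torus.norm_perturbedStressV_le (ν := ν) (u := v) (w' := D.wW' s) (ζ := D.zetaW s) (S₁ := D.S₁W s Rc) (f := D.ffunW s) (t := t)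
      (hw'.isContDiff (by simp)) y
    have e1 : ‖Torus.incr (D.wW' s) (D.zetaW s) t y‖ = ‖D.wW s t y‖ := rfl
    rw [e1] at this
    nlinarith [this]
  -- integrate the majorant
  have cS : Continuous fun y => ‖D.S₁W s Rc t y‖ := hS₁.continuous.norm
  have cvw : Continuous fun y => ‖v t y‖ * ‖D.wW s t y‖ := hvc.norm.mul hw.continuous.norm
  have cd : ∀ i, Continuous fun y => ‖Torus.partialDeriv i (D.wW' s t) y‖ := fun i => (hw'.partialDeriv i).continuous.norm
  have csum : Continuous fun y => ∑ i, ‖Torus.partialDeriv i (D.wW' s t) y‖ := continuous_finsetSum _ fun i _ => cd i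
  have cA : Continuous fun y => ‖Torus.antidivergence (D.ffunW s t) y‖ := hAf.continuous.norm
  have imaj : Integrable (fun y => 2 * ‖D.S₁W s Rc t y‖ + 4 * (‖v t y‖ * ‖D.wW s t y‖) + 4 * |ν| * ∑ i, ‖Torus.partialDeriv i (D.wW' s t) y‖ +
      ‖Torus.antidivergence (D.ffunW s t) y‖) volume :=
    ((((cS.const_mul 2).add (cvw.const_mul 4)).add (csum.const_mul _)).add cA).integrable_unitAddTorus
  have step1 : ∫ y, ‖Torus.perturbedStressV ν v (D.wW' s) (D.zetaW s) (D.S₁W s Rc) (D.ffunW s) t y‖ ≤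
      2 * (∫ y, ‖D.S₁W s Rc t y‖) + 4 * (∫ y, ‖v t y‖ * ‖D.wW s t y‖) + 4 * |ν| * (∫ y, ∑ i, ‖Torus.partialDeriv i (D.wW' s t) y‖) +
      ∫ y, ‖Torus.antidivergence (D.ffunW s t) y‖ := by
    refine (integral_mono_of_nonneg (Eventually.of_forall fun y => norm_nonneg _) imaj (Eventually.of_forall hpt)).trans (le_of_eq ?_)
    have i1 : Integrable (fun y => 2 * ‖D.S₁W s Rc t y‖) volume := (cS.const_mul 2).integrable_unitAddTorus
    have i2 : Integrable (fun y => 4 * (‖v t y‖ * ‖D.wW s t y‖)) volume := (cvw.const_mul 4).integrable_unitAddTorus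
    have i3 : Integrable (fun y => 4 * |ν| * ∑ i, ‖Torus.partialDeriv i (D.wW' s t) y‖) volume := (csum.const_mul _).integrable_unitAddTorus
    have i12 : Integrable (fun y => 2 * ‖D.S₁W s Rc t y‖ + 4 * (‖v t y‖ * ‖D.wW s t y‖)) volume := i1.add i2
    have i123 : Integrable (fun y => 2 * ‖D.S₁W s Rc t y‖ + 4 * (‖v t y‖ * ‖D.wW s t y‖) + 4 * |ν| * ∑ i, ‖Torus.partialDeriv i (D.wW' s t) y‖) volume :=
      i12.add i3
    rw [integral_add i123 cA.integrable_unitAddTorus, integral_add i12 i3, integral_add i1 i2,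
      integral_const_mul, integral_const_mul, integral_const_mul]
  -- (i) `S̃₁`
  have hEr := integral_norm_wrW_sq_le h hs ht h01 hSc hLc hEX hEζ
  have bS : ∫ y, ‖D.S₁W s Rc t y‖ ≤ ρc + (2 * (Real.sqrt Ep * Real.sqrt (3 * (Sc * Lc + EX + Eζ))) + 3 * (Sc * Lc + EX + Eζ)) + LS := by
    have hcr := integral_norm_crossW_le h hs ht h01 hEp hEr
    have hSo := isSmooth_Sosc h ht
    have hpt' : ∀ y, ‖D.S₁W s Rc t y‖ ≤ ‖Rc t y‖ + ‖D.crossW s t y‖ + ‖D.Sosc t y‖ := fun y => by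
      have e : D.S₁W s Rc t y = Rc t y + D.crossW s t y + (s t) ^ 2 • D.Sosc t y := by funext j; rfl
      rw [e]
      have n3 : ‖(s t) ^ 2 • D.Sosc t y‖ ≤ ‖D.Sosc t y‖ := by
        rw [norm_smul, Real.norm_eq_abs]; exact (mul_le_mul_of_nonneg_right hs2' (norm_nonneg _)).trans (by rw [one_mul])
      exact (norm_add_le _ _).trans (add_le_add (norm_add_le _ _) n3)
    have cR : Continuous fun y => ‖Rc t y‖ := (hRc.isSmooth_slice ht).continuous.norm
    have cc : Continuous fun y => ‖D.crossW s t y‖ := (isSmooth_crossW h hs ht).continuous.norm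
    have co : Continuous fun y => ‖D.Sosc t y‖ := hSo.continuous.norm
    have iRc : Integrable (fun y => ‖Rc t y‖ + ‖D.crossW s t y‖) volume := (cR.add cc).integrable_unitAddTorus
    have iRcS : Integrable (fun y => ‖Rc t y‖ + ‖D.crossW s t y‖ + ‖D.Sosc t y‖) volume := ((cR.add cc).add co).integrable_unitAddTorus
    calc ∫ y, ‖D.S₁W s Rc t y‖ ≤ ∫ y, (‖Rc t y‖ + ‖D.crossW s t y‖ + ‖D.Sosc t y‖) := integral_mono cS.integrable_unitAddTorus iRcS hpt'
      _ = (∫ y, ‖Rc t y‖) + (∫ y, ‖D.crossW s t y‖) + ∫ y, ‖D.Sosc t y‖ := by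
          rw [integral_add iRc co.integrable_unitAddTorus, integral_add cR.integrable_unitAddTorus cc.integrable_unitAddTorus]
      _ ≤ ρc + (2 * (Real.sqrt Ep * Real.sqrt (3 * (Sc * Lc + EX + Eζ))) + 3 * (Sc * Lc + EX + Eζ)) + LS := by
          refine add_le_add (add_le_add ?_ hcr) hS
          calc ∫ y, ‖Rc t y‖ ≤ ∫ _y : 𝕋³, ρc := integral_mono cR.integrable_unitAddTorus (integrable_const _) hρ
            _ = ρc := by simp
  -- (ii) the linear term
  have hIw : ∫ y, ‖D.wW s t y‖ ≤ Lp + Lc + Real.sqrt EX + Real.sqrt Eζ := integral_norm_wW_le h hs ht h01 hLp hLc hEX hEζ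
  have bL : ∫ y, ‖v t y‖ * ‖D.wW s t y‖ ≤ V₀ * (Lp + Lc + Real.sqrt EX + Real.sqrt Eζ) := by
    calc ∫ y, ‖v t y‖ * ‖D.wW s t y‖ ≤ ∫ y, V₀ * ‖D.wW s t y‖ :=
          integral_mono cvw.integrable_unitAddTorus (hw.continuous.norm.const_mul _).integrable_unitAddTorus fun y =>
            mul_le_mul_of_nonneg_right (hV y) (norm_nonneg _)
      _ ≤ V₀ * (Lp + Lc + Real.sqrt EX + Real.sqrt Eζ) := by rw [integral_const_mul]; exact mul_le_mul_of_nonneg_left hIw hV0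
  -- (iii) the dissipative term
  have bD : ∫ y, ∑ i, ‖Torus.partialDeriv i (D.wW' s t) y‖ ≤ 3 * (LdW + LdX) := by
    rw [integral_finsetSum _ fun i _ => (cd i).integrable_unitAddTorus]
    calc ∑ i, ∫ y, ‖Torus.partialDeriv i (D.wW' s t) y‖ ≤ ∑ _i : Fin 3, (LdW + LdX) := Finset.sum_le_sum fun i _ => by
          have h1 : Torus.IsSmooth (fun z => s t • D.wpc t z) := hwpc.smul (s t)
          have h2 : Torus.IsSmooth (fun z => (s t) ^ 2 • D.X t z) := hX.smul ((s t) ^ 2)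
          have e : Torus.partialDeriv i (D.wW' s t) = fun y => s t • Torus.partialDeriv i (D.wpc t) y + (s t) ^ 2 • Torus.partialDeriv i (D.X t) y := by
            rw [show D.wW' s t = (fun z => s t • D.wpc t z) + fun z => (s t) ^ 2 • D.X t z from rfl,
              Torus.partialDeriv_add (h1.isContDiff (by simp)) (h2.isContDiff (by simp)),
              show (fun z => s t • D.wpc t z) = s t • D.wpc t from rfl, Torus.partialDeriv_const_smul (hwpc.isContDiff (by simp)),
              show (fun z => (s t) ^ 2 • D.X t z) = (s t) ^ 2 • D.X t from rfl, Torus.partialDeriv_const_smul (hX.isContDiff (by simp))]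
            rfl
          rw [e]
          have c1 : Continuous fun y => ‖Torus.partialDeriv i (D.wpc t) y‖ := (hwpc.partialDeriv i).continuous.norm
          have c2 : Continuous fun y => ‖Torus.partialDeriv i (D.X t) y‖ := (hX.partialDeriv i).continuous.norm
          have hpt2 : ∀ y, ‖s t • Torus.partialDeriv i (D.wpc t) y + (s t) ^ 2 • Torus.partialDeriv i (D.X t) y‖ ≤
              ‖Torus.partialDeriv i (D.wpc t) y‖ + ‖Torus.partialDeriv i (D.X t) y‖ := fun y => by
            refine (norm_add_le _ _).trans (add_le_add ?_ ?_)
            · rw [norm_smul, Real.norm_eq_abs]; exact (mul_le_mul_of_nonneg_right hs1 (norm_nonneg _)).trans (by rw [one_mul])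
            · rw [norm_smul, Real.norm_eq_abs]; exact (mul_le_mul_of_nonneg_right hs2' (norm_nonneg _)).trans (by rw [one_mul])
          have csm : Continuous fun y => s t • Torus.partialDeriv i (D.wpc t) y + (s t) ^ 2 • Torus.partialDeriv i (D.X t) y :=
            ((hwpc.partialDeriv i).continuous.const_smul (s t)).add ((hX.partialDeriv i).continuous.const_smul ((s t) ^ 2))
          calc ∫ y, ‖s t • Torus.partialDeriv i (D.wpc t) y + (s t) ^ 2 • Torus.partialDeriv i (D.X t) y‖
              ≤ ∫ y, (‖Torus.partialDeriv i (D.wpc t) y‖ + ‖Torus.partialDeriv i (D.X t) y‖) :=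
                integral_mono csm.norm.integrable_unitAddTorus (c1.add c2).integrable_unitAddTorus hpt2
            _ ≤ LdW + LdX := by rw [integral_add c1.integrable_unitAddTorus c2.integrable_unitAddTorus]; exact add_le_add (hdW i) (hdX i)
      _ = 3 * (LdW + LdX) := by simp only [Finset.sum_const, Finset.card_univ, Fintype.card_fin, nsmul_eq_mul, Nat.cast_ofNat]
  -- (iv) the antidivergence term
  have bA : ∫ y, ‖Torus.antidivergence (D.ffunW s t) y‖ ≤ Lf₁ + (C₁ : ℝ) * (2 * (Lf₂ + Lf₃) + S' * (Lp + Lc + 2 * Real.sqrt EX)) := by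
    have e : D.ffunW s t = (fun y => s t • D.f₁ t y) +
        (fun y => (s t) ^ 2 • (D.f₂ t y + D.f₃ t y + D.f₄ t) + D.sdot s t • D.wpc t y + (2 * s t * D.sdot s t) • D.X t y) := by
      funext y; show D.ffunW s t y = _; simp only [ffunW, Pi.add_apply]; abel
    rw [e, Torus.antidivergence_add hsf1 hg]
    have cA1 : Continuous fun y => ‖Torus.antidivergence (fun y => s t • D.f₁ t y) y‖ := (Torus.isSmooth_antidivergence hsf1).continuous.norm
    have cA2 : Continuous fun y => ‖Torus.antidivergence
        (fun y => (s t) ^ 2 • (D.f₂ t y + D.f₃ t y + D.f₄ t) + D.sdot s t • D.wpc t y + (2 * s t * D.sdot s t) • D.X t y) y‖ :=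
      (Torus.isSmooth_antidivergence hg).continuous.norm
    -- the `f₁` part
    have hA1 : ∫ y, ‖Torus.antidivergence (fun y => s t • D.f₁ t y) y‖ ≤ Lf₁ := by
      have e1 : Torus.antidivergence (fun y => s t • D.f₁ t y) = s t • Torus.antidivergence (D.f₁ t) := by
        rw [show (fun y => s t • D.f₁ t y) = s t • D.f₁ t from rfl, Torus.antidivergence_const_smul hf1]
      rw [e1]
      calc ∫ y, ‖(s t • Torus.antidivergence (D.f₁ t)) y‖ ≤ ∫ y, ‖Torus.antidivergence (D.f₁ t) y‖ :=
            integral_mono (by rw [← e1]; exact cA1.integrable_unitAddTorus) (Torus.isSmooth_antidivergence hf1).continuous.norm.integrable_unitAddTorus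
              fun y => by
                rw [Pi.smul_apply, norm_smul, Real.norm_eq_abs]
                exact (mul_le_mul_of_nonneg_right hs1 (norm_nonneg _)).trans (by rw [one_mul])
        _ ≤ Lf₁ := hf₁
    -- the rest, through the `L¹` bound of `ℛ`
    have hg1 : ∫ y, ‖(s t) ^ 2 • (D.f₂ t y + D.f₃ t y + D.f₄ t) + D.sdot s t • D.wpc t y + (2 * s t * D.sdot s t) • D.X t y‖ ≤
        2 * (Lf₂ + Lf₃) + S' * (Lp + Lc + 2 * Real.sqrt EX) := by
      have c2 : Continuous fun y => ‖D.f₂ t y‖ := hf2.continuous.norm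
      have c3 : Continuous fun y => ‖D.f₃ t y‖ := hf3.continuous.norm
      have cw : Continuous fun y => ‖D.wpc t y‖ := hwpc.continuous.norm
      have cX : Continuous fun y => ‖D.X t y‖ := hX.continuous.norm
      have h4 := norm_f₄_le h hRc ht
      -- `∫‖wpc‖ ≤ Lp + Lc`
      have hwpcL : ∫ y, ‖D.wpc t y‖ ≤ Lp + Lc := by
        have cwp : Continuous fun y => ‖D.wp t y‖ := hwp.continuous.norm
        have cwc : Continuous fun y => ‖D.wpc t y - D.wp t y‖ := (hwpc.sub hwp).continuous.norm
        calc ∫ y, ‖D.wpc t y‖ ≤ ∫ y, (‖D.wp t y‖ + ‖D.wpc t y - D.wp t y‖) :=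
              integral_mono cw.integrable_unitAddTorus (cwp.add cwc).integrable_unitAddTorus fun y => by
                have : D.wpc t y = D.wp t y + (D.wpc t y - D.wp t y) := by abel
                rw [this]; exact (norm_add_le _ _).trans (by rw [← this])
          _ ≤ Lp + Lc := by rw [integral_add cwp.integrable_unitAddTorus cwc.integrable_unitAddTorus]; exact add_le_add hLp hLc
      have hXL : ∫ y, ‖D.X t y‖ ≤ Real.sqrt EX := integral_norm_le_sqrt hX.continuous hEX
      have hpt3 : ∀ y, ‖(s t) ^ 2 • (D.f₂ t y + D.f₃ t y + D.f₄ t) + D.sdot s t • D.wpc t y + (2 * s t * D.sdot s t) • D.X t y‖ ≤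
          (‖D.f₂ t y‖ + ‖D.f₃ t y‖ + ‖D.f₄ t‖) + S' * ‖D.wpc t y‖ + (2 * S') * ‖D.X t y‖ := by
        intro y
        have n1 : ‖(s t) ^ 2 • (D.f₂ t y + D.f₃ t y + D.f₄ t)‖ ≤ ‖D.f₂ t y‖ + ‖D.f₃ t y‖ + ‖D.f₄ t‖ := by
          rw [norm_smul, Real.norm_eq_abs]
          refine (mul_le_mul_of_nonneg_right hs2' (norm_nonneg _)).trans ?_
          rw [one_mul]; exact (norm_add_le _ _).trans (add_le_add (norm_add_le _ _) le_rfl)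
        have n2 : ‖D.sdot s t • D.wpc t y‖ ≤ S' * ‖D.wpc t y‖ := by
          rw [norm_smul, Real.norm_eq_abs]; exact mul_le_mul_of_nonneg_right hS' (norm_nonneg _)
        have n3 : ‖(2 * s t * D.sdot s t) • D.X t y‖ ≤ (2 * S') * ‖D.X t y‖ := by
          rw [norm_smul, Real.norm_eq_abs]
          refine mul_le_mul_of_nonneg_right ?_ (norm_nonneg _)
          rw [abs_mul, abs_mul, abs_two]
          calc 2 * |s t| * |D.sdot s t| ≤ 2 * 1 * S' := mul_le_mul (mul_le_mul_of_nonneg_left hs1 (by norm_num)) hS' (abs_nonneg _) (by norm_num)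
            _ = 2 * S' := by ring
        exact (norm_add_le _ _).trans (add_le_add ((norm_add_le _ _).trans (add_le_add n1 n2)) n3)
      have k23 : Integrable (fun y => ‖D.f₂ t y‖ + ‖D.f₃ t y‖) volume := (c2.add c3).integrable_unitAddTorus
      have k234 : Integrable (fun y => ‖D.f₂ t y‖ + ‖D.f₃ t y‖ + ‖D.f₄ t‖) volume := ((c2.add c3).add continuous_const).integrable_unitAddTorus
      have kw : Integrable (fun y => S' * ‖D.wpc t y‖) volume := (cw.const_mul _).integrable_unitAddTorus
      have kX : Integrable (fun y => (2 * S') * ‖D.X t y‖) volume := (cX.const_mul _).integrable_unitAddTorus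
      have k1 : Integrable (fun y => (‖D.f₂ t y‖ + ‖D.f₃ t y‖ + ‖D.f₄ t‖) + S' * ‖D.wpc t y‖) volume := k234.add kw
      have k2 : Integrable (fun y => (‖D.f₂ t y‖ + ‖D.f₃ t y‖ + ‖D.f₄ t‖) + S' * ‖D.wpc t y‖ + (2 * S') * ‖D.X t y‖) volume := k1.add kX
      calc ∫ y, ‖(s t) ^ 2 • (D.f₂ t y + D.f₃ t y + D.f₄ t) + D.sdot s t • D.wpc t y + (2 * s t * D.sdot s t) • D.X t y‖
          ≤ ∫ y, ((‖D.f₂ t y‖ + ‖D.f₃ t y‖ + ‖D.f₄ t‖) + S' * ‖D.wpc t y‖ + (2 * S') * ‖D.X t y‖) :=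
            integral_mono hg.continuous.norm.integrable_unitAddTorus k2 hpt3
        _ = ((∫ y, ‖D.f₂ t y‖) + (∫ y, ‖D.f₃ t y‖) + ‖D.f₄ t‖) + S' * (∫ y, ‖D.wpc t y‖) + (2 * S') * ∫ y, ‖D.X t y‖ := by
            rw [integral_add k1 kX, integral_add k234 kw, integral_add k23 (integrable_const _),
              integral_add c2.integrable_unitAddTorus c3.integrable_unitAddTorus, integral_const_mul, integral_const_mul]
            simp
        _ ≤ (Lf₂ + Lf₃ + (Lf₂ + Lf₃)) + S' * (Lp + Lc) + (2 * S') * Real.sqrt EX := by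
            gcongr
            exact h4.trans (add_le_add hf₂ hf₃)
        _ = 2 * (Lf₂ + Lf₃) + S' * (Lp + Lc + 2 * Real.sqrt EX) := by ring
    calc ∫ y, ‖(Torus.antidivergence (fun y => s t • D.f₁ t y) + Torus.antidivergence
          (fun y => (s t) ^ 2 • (D.f₂ t y + D.f₃ t y + D.f₄ t) + D.sdot s t • D.wpc t y + (2 * s t * D.sdot s t) • D.X t y)) y‖
        ≤ ∫ y, (‖Torus.antidivergence (fun y => s t • D.f₁ t y) y‖ + ‖Torus.antidivergence
          (fun y => (s t) ^ 2 • (D.f₂ t y + D.f₃ t y + D.f₄ t) + D.sdot s t • D.wpc t y + (2 * s t * D.sdot s t) • D.X t y) y‖) :=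
          integral_mono (by rw [← Torus.antidivergence_add hsf1 hg, ← e]; exact cA.integrable_unitAddTorus) (cA1.add cA2).integrable_unitAddTorus
            fun y => norm_add_le _ _
      _ ≤ Lf₁ + (C₁ : ℝ) * (2 * (Lf₂ + Lf₃) + S' * (Lp + Lc + 2 * Real.sqrt EX)) := by
          rw [integral_add cA1.integrable_unitAddTorus cA2.integrable_unitAddTorus]
          exact add_le_add hA1 ((integral_norm_antidivergence_le hC₁ hg).trans (mul_le_mul_of_nonneg_left hg1 C₁.coe_nonneg))
  -- assemble
  have hν : 0 ≤ 4 * |ν| := by positivity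
  calc _ ≤ _ := step1
    _ ≤ _ := by
        have := mul_le_mul_of_nonneg_left bS (by norm_num : (0:ℝ) ≤ 2)
        have := mul_le_mul_of_nonneg_left bL (by norm_num : (0:ℝ) ≤ 4)
        have := mul_le_mul_of_nonneg_left bD hν
        linarith

/-! ## Sup sizes -/

section Sup

include hA hB hB1 hs

omit hs in
/-- **`sup‖w̃‖ ≤ wSup`** for `0 ≤ s ≤ 1`. [cite: BuckmasterVicol2019Annals, §2 (2.3)] -/
theorem norm_wW_le_sup (hK : ∀ φ : 𝕋³ → ℝ, Torus.IsSmooth φ → ∀ (i j : Fin 3) (y : 𝕋³), ‖Torus.partialDeriv i (Torus.partialDeriv j φ) y‖ₑ ≤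
      K * ∑ m, eLpNorm (Torus.partialDeriv m (Torus.laplacian φ)) (ENNReal.ofReal ((Fintype.card (Fin 3) : ℝ) + 2)) volume)
    {t : ℝ} (ht : t ∈ Icc 0 D.T) (h01 : 0 ≤ s t ∧ s t ≤ 1) (y : 𝕋³) : ‖D.wW s t y‖ ≤ D.wSup A₀ A₁ H₁ B K := by
  obtain ⟨hs1, hs2, hs2'⟩ := weight_le_one h h01
  have hζ : Torus.IsSmooth (D.zeta t) := (smooth_zeta h).isSmooth_slice ht
  have e : D.wW s t y = s t • D.wp t y + (s t • (D.wpc t y - D.wp t y) + (s t) ^ 2 • D.X t y + (s t) ^ 2 • Torus.gradient (D.zeta t) y) := by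
    rw [← wrW_eq ht y hζ]; simp [wrW]
  have hg : ‖Torus.gradient (D.zeta t) y‖ ≤ 3 * D.zSup A₀ H₁ B K := by
    refine (norm_gradient_le (hζ.isContDiff (by simp)) y).trans ?_
    calc ∑ i, |Torus.partialDeriv i (D.zeta t) y| ≤ ∑ _i : Fin 3, D.zSup A₀ H₁ B K :=
          Finset.sum_le_sum fun i _ => abs_partialDeriv_zeta_le_sup h hA hB hB1 hK ht i y
      _ = 3 * D.zSup A₀ H₁ B K := by simp only [Finset.sum_const, Finset.card_univ, Fintype.card_fin, nsmul_eq_mul, Nat.cast_ofNat]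
  rw [e]
  have n0 : ‖s t • D.wp t y‖ ≤ ‖D.wp t y‖ := by
    rw [norm_smul, Real.norm_eq_abs]; exact (mul_le_mul_of_nonneg_right hs1 (norm_nonneg _)).trans (by rw [one_mul])
  have n1 : ‖s t • (D.wpc t y - D.wp t y)‖ ≤ ‖D.wpc t y - D.wp t y‖ := by
    rw [norm_smul, Real.norm_eq_abs]; exact (mul_le_mul_of_nonneg_right hs1 (norm_nonneg _)).trans (by rw [one_mul])
  have n2 : ‖(s t) ^ 2 • D.X t y‖ ≤ ‖D.X t y‖ := by
    rw [norm_smul, Real.norm_eq_abs]; exact (mul_le_mul_of_nonneg_right hs2' (norm_nonneg _)).trans (by rw [one_mul])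
  have n3 : ‖(s t) ^ 2 • Torus.gradient (D.zeta t) y‖ ≤ ‖Torus.gradient (D.zeta t) y‖ := by
    rw [norm_smul, Real.norm_eq_abs]; exact (mul_le_mul_of_nonneg_right hs2' (norm_nonneg _)).trans (by rw [one_mul])
  have a1 : ‖D.wp t y‖ ≤ D.wpSup A₀ B := norm_wp_le_sup h hB hB1 hA ht y
  have a2 : ‖D.wpc t y - D.wp t y‖ ≤ D.wcSup A₀ A₁ B := norm_wc_le_sup h hB hB1 hA ht y
  have a3 : ‖D.X t y‖ ≤ D.XSup A₀ B := norm_X_le_sup h hB hB1 hA ht y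
  have t1 := norm_add_le (s t • D.wp t y) (s t • (D.wpc t y - D.wp t y) + (s t) ^ 2 • D.X t y + (s t) ^ 2 • Torus.gradient (D.zeta t) y)
  have t2 := norm_add_le (s t • (D.wpc t y - D.wp t y) + (s t) ^ 2 • D.X t y) ((s t) ^ 2 • Torus.gradient (D.zeta t) y)
  have t3 := norm_add_le (s t • (D.wpc t y - D.wp t y)) ((s t) ^ 2 • D.X t y)
  unfold wSup
  linarith

omit hs in
/-- **`sup‖∂ᵢw̃‖ ≤ dwSup`** for `0 ≤ s ≤ 1`. [cite: BuckmasterVicol2019Annals, §2 (2.3)] -/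
theorem norm_partialDeriv_wW_le_sup
    (hCψ : ∀ (x : Idx) (i l : Fin 3) (y : 𝕋³), |Torus.partialDeriv i (Torus.partialDeriv l (Jet.psiJ (D.J x) D.s x)) y| ≤ Cψ * (D.σ : ℝ) ^ 2 * D.μ ^ 3)
    (hK : ∀ φ : 𝕋³ → ℝ, Torus.IsSmooth φ → ∀ (i j : Fin 3) (y : 𝕋³), ‖Torus.partialDeriv i (Torus.partialDeriv j φ) y‖ₑ ≤
      K * ∑ m, eLpNorm (Torus.partialDeriv m (Torus.laplacian φ)) (ENNReal.ofReal ((Fintype.card (Fin 3) : ℝ) + 2)) volume)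
    {t : ℝ} (ht : t ∈ Icc 0 D.T) (h01 : 0 ≤ s t ∧ s t ≤ 1) (i : Fin 3) (y : 𝕋³) :
    ‖Torus.partialDeriv i (D.wW s t) y‖ ≤ D.dwSup A₀ A₁ A₂ H₁ H₂ B Cψ K := by
  obtain ⟨hs1, hs2, hs2'⟩ := weight_le_one h h01
  have hwpc : Torus.IsSmooth (D.wpc t) := (smooth_wpc h).isSmooth_slice ht
  have hX : Torus.IsSmooth (D.X t) := (smooth_X h).isSmooth_slice ht
  have hζ : Torus.IsSmooth (D.zeta t) := (smooth_zeta h).isSmooth_slice ht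
  have h1 : Torus.IsSmooth (fun z => s t • D.wpc t z) := hwpc.smul (s t)
  have h2 : Torus.IsSmooth (fun z => (s t) ^ 2 • D.X t z) := hX.smul ((s t) ^ 2)
  have h3 : Torus.IsSmooth (fun z => (s t) ^ 2 • Torus.gradient (D.zeta t) z) := hζ.gradient.smul ((s t) ^ 2)
  have eW : D.wW s t = fun z => s t • D.wpc t z + (s t) ^ 2 • D.X t z + (s t) ^ 2 • Torus.gradient (D.zeta t) z := by
    funext z
    show D.wW' s t z + Torus.gradient (D.zetaW s t) z = _
    rw [show D.zetaW s t = fun z => (s t) ^ 2 * D.zeta t z from rfl, Torus.gradient_const_mul_apply (hζ.isContDiff (by simp))]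
    rfl
  have e : Torus.partialDeriv i (D.wW s t) y = s t • Torus.partialDeriv i (D.wpc t) y + (s t) ^ 2 • Torus.partialDeriv i (D.X t) y +
      (s t) ^ 2 • Torus.partialDeriv i (Torus.gradient (D.zeta t)) y := by
    rw [eW]
    have := ((h1.hasDerivAt_line_zero i y).add (h2.hasDerivAt_line_zero i y)).add (h3.hasDerivAt_line_zero i y)
    have e0 : Torus.partialDeriv i (fun z => s t • D.wpc t z + (s t) ^ 2 • D.X t z + (s t) ^ 2 • Torus.gradient (D.zeta t) z) y =
        Torus.partialDeriv i (fun z => s t • D.wpc t z) y + Torus.partialDeriv i (fun z => (s t) ^ 2 • D.X t z) y +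
          Torus.partialDeriv i (fun z => (s t) ^ 2 • Torus.gradient (D.zeta t) z) y := this.deriv
    rw [e0, show (fun z => s t • D.wpc t z) = s t • D.wpc t from rfl, Torus.partialDeriv_const_smul (hwpc.isContDiff (by simp)),
      show (fun z => (s t) ^ 2 • D.X t z) = (s t) ^ 2 • D.X t from rfl, Torus.partialDeriv_const_smul (hX.isContDiff (by simp)),
      show (fun z => (s t) ^ 2 • Torus.gradient (D.zeta t) z) = (s t) ^ 2 • Torus.gradient (D.zeta t) from rfl,
      Torus.partialDeriv_const_smul (hζ.gradient.isContDiff (by simp))]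
    rfl
  rw [e]
  have hg : ‖Torus.partialDeriv i (Torus.gradient (D.zeta t)) y‖ ≤ 3 * D.zzSup A₀ H₁ H₂ B Cψ K := by
    refine (norm_partialDeriv_gradient_le hζ i y).trans ?_
    calc ∑ j, |Torus.partialDeriv i (Torus.partialDeriv j (D.zeta t)) y| ≤ ∑ _j : Fin 3, D.zzSup A₀ H₁ H₂ B Cψ K :=
          Finset.sum_le_sum fun j _ => abs_partialDeriv_partialDeriv_zeta_le_sup h hA hB hB1 hCψ hK ht i j y
      _ = _ := by simp only [Finset.sum_const, Finset.card_univ, Fintype.card_fin, nsmul_eq_mul, Nat.cast_ofNat]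
  have n1 : ‖s t • Torus.partialDeriv i (D.wpc t) y‖ ≤ ‖Torus.partialDeriv i (D.wpc t) y‖ := by
    rw [norm_smul, Real.norm_eq_abs]; exact (mul_le_mul_of_nonneg_right hs1 (norm_nonneg _)).trans (by rw [one_mul])
  have n2 : ‖(s t) ^ 2 • Torus.partialDeriv i (D.X t) y‖ ≤ ‖Torus.partialDeriv i (D.X t) y‖ := by
    rw [norm_smul, Real.norm_eq_abs]; exact (mul_le_mul_of_nonneg_right hs2' (norm_nonneg _)).trans (by rw [one_mul])
  have n3 : ‖(s t) ^ 2 • Torus.partialDeriv i (Torus.gradient (D.zeta t)) y‖ ≤ ‖Torus.partialDeriv i (Torus.gradient (D.zeta t)) y‖ := by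
    rw [norm_smul, Real.norm_eq_abs]; exact (mul_le_mul_of_nonneg_right hs2' (norm_nonneg _)).trans (by rw [one_mul])
  have a1 : ‖Torus.partialDeriv i (D.wpc t) y‖ ≤ D.dwpcSup A₀ A₁ A₂ B := norm_partialDeriv_wpc_le_sup h hA hB hB1 ht i y
  have a2 : ‖Torus.partialDeriv i (D.X t) y‖ ≤ D.dXSup A₀ H₁ B := norm_partialDeriv_X_le_sup h hA hB hB1 ht i y
  have t1 := norm_add_le (s t • Torus.partialDeriv i (D.wpc t) y + (s t) ^ 2 • Torus.partialDeriv i (D.X t) y)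
    ((s t) ^ 2 • Torus.partialDeriv i (Torus.gradient (D.zeta t)) y)
  have t2 := norm_add_le (s t • Torus.partialDeriv i (D.wpc t) y) ((s t) ^ 2 • Torus.partialDeriv i (D.X t) y)
  unfold dwSup
  linarith

omit hA hB hB1 in
/-- **`∂ₜζ̃ = 2 s s' ζ + s² ∂ₜζ`**. [folklore] -/
theorem zetaWdot_eq {t : ℝ} (ht : t ∈ Icc 0 D.T) (y : 𝕋³) :
    D.zetaWdot s t y = (2 * s t * D.sdot s t) * D.zeta t y + (s t) ^ 2 * D.zetadot t y := by
  have hU := uniqueDiffOn h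
  have hsd : HasDerivWithinAt s (D.sdot s t) (Icc 0 D.T) t := ((hs.differentiableOn (by simp)) t ht).hasDerivWithinAt
  have hsd2 : HasDerivWithinAt (fun τ => (s τ) ^ 2) (2 * s t * D.sdot s t) (Icc 0 D.T) t := by
    have e : (fun τ => (s τ) ^ 2) = s * s := by funext τ; simp [sq]
    rw [e]
    refine (hsd.mul hsd).congr_deriv ?_
    ring
  have hz : HasDerivWithinAt (fun τ => D.zeta τ y) (D.zetadot t y) (Icc 0 D.T) t := (smooth_zeta h).hasDerivWithinAt_slice ht y
  have key : HasDerivWithinAt (fun τ => (s τ) ^ 2 * D.zeta τ y) ((2 * s t * D.sdot s t) * D.zeta t y + (s t) ^ 2 * D.zetadot t y)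
      (Icc 0 D.T) t := hsd2.mul hz
  show derivWithin (fun τ => D.zetaW s τ y) (Icc 0 D.T) t = _
  rw [show (fun τ => D.zetaW s τ y) = fun τ => (s τ) ^ 2 * D.zeta τ y from rfl, key.derivWithin (hU t ht)]

/-- **`sup‖∂ₜw̃‖ ≤ dtwSup + 2 S' wSup`** for `0 ≤ s ≤ 1`, `|s'| ≤ S'`. [cite: BuckmasterVicol2019Annals, §2 (2.3)] -/
theorem norm_timeDerivWithin_wW_le_sup
    (hK : ∀ φ : 𝕋³ → ℝ, Torus.IsSmooth φ → ∀ (i j : Fin 3) (y : 𝕋³), ‖Torus.partialDeriv i (Torus.partialDeriv j φ) y‖ₑ ≤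
      K * ∑ m, eLpNorm (Torus.partialDeriv m (Torus.laplacian φ)) (ENNReal.ofReal ((Fintype.card (Fin 3) : ℝ) + 2)) volume)
    (hK₁ : ∀ g : 𝕋³ → ℝ, Torus.IsSmooth g → ∀ (i : Fin 3) (y : 𝕋³), ‖Torus.partialDeriv i (Torus.invLaplacian g) y‖ₑ ≤ K₁ * eLpNorm g ⊤ volume)
    {t : ℝ} (ht : t ∈ Icc 0 D.T) (h01 : 0 ≤ s t ∧ s t ≤ 1) {S' : ℝ} (hS' : |D.sdot s t| ≤ S') (y : 𝕋³) :
    ‖Torus.timeDerivWithin (Icc 0 D.T) (D.wW s) t y‖ ≤ D.dtwSup A₀ A₁ A₂ H₁ H₂ B K₁ + S' * (2 * D.wSup A₀ A₁ H₁ B K) := by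
  obtain ⟨hs1, hs2, hs2'⟩ := weight_le_one h h01
  have hS'0 : 0 ≤ S' := (abs_nonneg _).trans hS'
  rw [timeDerivWithin_wW h hs ht y]
  have hζ : Torus.IsSmooth (D.zeta t) := (smooth_zeta h).isSmooth_slice ht
  have hzd : Torus.IsSmooth (D.zetadot t) := (smooth_zetadot h).isSmooth_slice ht
  -- the gradient part
  have eg : Torus.gradient (D.zetaWdot s t) y = (2 * s t * D.sdot s t) • Torus.gradient (D.zeta t) y + (s t) ^ 2 • Torus.gradient (D.zetadot t) y := by
    have e1 : D.zetaWdot s t = fun z => (2 * s t * D.sdot s t) * D.zeta t z + (s t) ^ 2 * D.zetadot t z := funext (zetaWdot_eq h hs ht)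
    have m1 : Torus.IsSmooth (fun z => (2 * s t * D.sdot s t) * D.zeta t z) := (Torus.isSmooth_const _).mul hζ
    have m2 : Torus.IsSmooth (fun z => (s t) ^ 2 * D.zetadot t z) := (Torus.isSmooth_const _).mul hzd
    have c1 : Torus.IsContDiff 1 (fun z => (2 * s t * D.sdot s t) * D.zeta t z) := m1.isContDiff (by simp)
    have c2 : Torus.IsContDiff 1 (fun z => (s t) ^ 2 * D.zetadot t z) := m2.isContDiff (by simp)
    rw [e1, Torus.gradient_add_apply c1 c2, Torus.gradient_const_mul_apply (hζ.isContDiff (by simp)),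
      Torus.gradient_const_mul_apply (hzd.isContDiff (by simp))]
  have hgζ : ‖Torus.gradient (D.zeta t) y‖ ≤ 3 * D.zSup A₀ H₁ B K := by
    refine (norm_gradient_le (hζ.isContDiff (by simp)) y).trans ?_
    calc ∑ i, |Torus.partialDeriv i (D.zeta t) y| ≤ ∑ _i : Fin 3, D.zSup A₀ H₁ B K :=
          Finset.sum_le_sum fun i _ => abs_partialDeriv_zeta_le_sup h hA hB hB1 hK ht i y
      _ = 3 * D.zSup A₀ H₁ B K := by simp only [Finset.sum_const, Finset.card_univ, Fintype.card_fin, nsmul_eq_mul, Nat.cast_ofNat]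
  have hgz : ‖Torus.gradient (D.zetadot t) y‖ ≤ 3 * D.zdotSup A₀ H₁ H₂ B K₁ := by
    refine (norm_gradient_le (hzd.isContDiff (by simp)) y).trans ?_
    calc ∑ i, |Torus.partialDeriv i (D.zetadot t) y| ≤ ∑ _i : Fin 3, D.zdotSup A₀ H₁ H₂ B K₁ :=
          Finset.sum_le_sum fun i _ => abs_partialDeriv_zetadot_le_sup h hA hB hB1 hK₁ ht i y
      _ = _ := by simp only [Finset.sum_const, Finset.card_univ, Fintype.card_fin, nsmul_eq_mul, Nat.cast_ofNat]
  have h2s : |2 * s t * D.sdot s t| ≤ 2 * S' := by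
    rw [abs_mul, abs_mul, abs_two]
    calc 2 * |s t| * |D.sdot s t| ≤ 2 * 1 * S' := mul_le_mul (mul_le_mul_of_nonneg_left hs1 (by norm_num)) hS' (abs_nonneg _) (by norm_num)
      _ = 2 * S' := by ring
  -- the pieces
  have a1 : ‖D.wp t y‖ ≤ D.wpSup A₀ B := norm_wp_le_sup h hB hB1 hA ht y
  have a2 : ‖D.wpc t y - D.wp t y‖ ≤ D.wcSup A₀ A₁ B := norm_wc_le_sup h hB hB1 hA ht y
  have a3 : ‖D.X t y‖ ≤ D.XSup A₀ B := norm_X_le_sup h hB hB1 hA ht y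
  have a4 : ‖Torus.timeDerivWithin (Icc 0 D.T) D.wpc t y‖ ≤ D.dtwpcSup A₀ A₁ A₂ B := norm_timeDerivWithin_wpc_le_sup h hA hB hB1 ht y
  have a5 : ‖Torus.timeDerivWithin (Icc 0 D.T) D.X t y‖ ≤ D.dtXSup A₀ H₁ B := norm_timeDerivWithin_X_le_sup h hA hB hB1 ht y
  have hwpc : ‖D.wpc t y‖ ≤ D.wpSup A₀ B + D.wcSup A₀ A₁ B := by
    have : D.wpc t y = D.wp t y + (D.wpc t y - D.wp t y) := by abel
    rw [this]; exact (norm_add_le _ _).trans (add_le_add a1 a2)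
  have n1 : ‖D.sdot s t • D.wpc t y‖ ≤ S' * (D.wpSup A₀ B + D.wcSup A₀ A₁ B) := by
    rw [norm_smul, Real.norm_eq_abs]; exact mul_le_mul hS' hwpc (norm_nonneg _) hS'0
  have n2 : ‖s t • Torus.timeDerivWithin (Icc 0 D.T) D.wpc t y‖ ≤ D.dtwpcSup A₀ A₁ A₂ B := by
    rw [norm_smul, Real.norm_eq_abs]; exact (mul_le_mul_of_nonneg_right hs1 (norm_nonneg _)).trans (by rw [one_mul]; exact a4)
  have n3 : ‖(2 * s t * D.sdot s t) • D.X t y‖ ≤ (2 * S') * D.XSup A₀ B := by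
    rw [norm_smul, Real.norm_eq_abs]; exact mul_le_mul h2s a3 (norm_nonneg _) (by positivity)
  have n4 : ‖(s t) ^ 2 • Torus.timeDerivWithin (Icc 0 D.T) D.X t y‖ ≤ D.dtXSup A₀ H₁ B := by
    rw [norm_smul, Real.norm_eq_abs]; exact (mul_le_mul_of_nonneg_right hs2' (norm_nonneg _)).trans (by rw [one_mul]; exact a5)
  have n5 : ‖Torus.gradient (D.zetaWdot s t) y‖ ≤ (2 * S') * (3 * D.zSup A₀ H₁ B K) + 3 * D.zdotSup A₀ H₁ H₂ B K₁ := by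
    rw [eg]
    refine (norm_add_le _ _).trans (add_le_add ?_ ?_)
    · rw [norm_smul, Real.norm_eq_abs]; exact mul_le_mul h2s hgζ (norm_nonneg _) (by positivity)
    · rw [norm_smul, Real.norm_eq_abs]; exact (mul_le_mul_of_nonneg_right hs2' (norm_nonneg _)).trans (by rw [one_mul]; exact hgz)
  have hz0 : 0 ≤ D.zSup A₀ H₁ B K := by
    have := abs_partialDeriv_zeta_le_sup h hA hB hB1 hK ht 0 y; exact (abs_nonneg _).trans this
  have hX0 : 0 ≤ D.XSup A₀ B := (norm_nonneg _).trans a3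
  have t1 := norm_add_le (D.sdot s t • D.wpc t y + s t • Torus.timeDerivWithin (Icc 0 D.T) D.wpc t y +
    ((2 * s t * D.sdot s t) • D.X t y + (s t) ^ 2 • Torus.timeDerivWithin (Icc 0 D.T) D.X t y)) (Torus.gradient (D.zetaWdot s t) y)
  have t2 := norm_add_le (D.sdot s t • D.wpc t y + s t • Torus.timeDerivWithin (Icc 0 D.T) D.wpc t y)
    ((2 * s t * D.sdot s t) • D.X t y + (s t) ^ 2 • Torus.timeDerivWithin (Icc 0 D.T) D.X t y)
  have t3 := norm_add_le (D.sdot s t • D.wpc t y) (s t • Torus.timeDerivWithin (Icc 0 D.T) D.wpc t y)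
  have t4 := norm_add_le ((2 * s t * D.sdot s t) • D.X t y) ((s t) ^ 2 • Torus.timeDerivWithin (Icc 0 D.T) D.X t y)
  have hp0 : 0 ≤ D.wpSup A₀ B := (norm_nonneg _).trans a1
  have hc0 : 0 ≤ D.wcSup A₀ A₁ B := (norm_nonneg _).trans a2
  have p1 := mul_nonneg hS'0 hz0
  have p2 := mul_nonneg hS'0 hX0
  have p3 := mul_nonneg hS'0 hp0
  have p4 := mul_nonneg hS'0 hc0
  unfold dtwSup wSup
  linarith

omit hA hB hB1 in
/-- **The sup size of the weighted new stress at time `t`**, from sizes of the pieces: the unweighted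
sizes plus the cut-off terms `K_ℛ S' (sup wp + sup wc + 2 sup X)`. [cite: BuckmasterVicol2020, §7.6.2 (7.48)] -/
theorem norm_newStressW_le_sup {ν : ℝ} {v : ℝ → 𝕋³ → E³} {Rc : ℝ → 𝕋³ → Fin 3 → E³} (hRc : Torus.IsSmoothSpaceTimeOn (Icc 0 D.T) Rc)
    {t : ℝ} (ht : t ∈ Icc 0 D.T) (h01 : 0 ≤ s t ∧ s t ≤ 1) {S' : ℝ} (hS' : |D.sdot s t| ≤ S')
    {V₀ ρc Sw Sp Sc SX Sd SS Sf Kℛ : ℝ} (hV : ∀ y, ‖v t y‖ ≤ V₀) (hρ : ∀ y, ‖Rc t y‖ ≤ ρc)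
    (hSw : ∀ y, ‖D.wW s t y‖ ≤ Sw) (hSp : ∀ y, ‖D.wp t y‖ ≤ Sp) (hSc : ∀ y, ‖D.wpc t y - D.wp t y‖ ≤ Sc) (hSX : ∀ y, ‖D.X t y‖ ≤ SX)
    (hSd : ∀ i y, ‖Torus.partialDeriv i (D.wW' s t) y‖ ≤ Sd)
    (hSS : ∀ y, ‖D.Sosc t y‖ ≤ SS) (hSf : ∀ y, ‖D.f₁ t y‖ + ‖D.f₂ t y‖ + ‖D.f₃ t y‖ + ‖D.f₄ t‖ ≤ Sf)
    (hKℛ : ∀ g : 𝕋³ → E³, Torus.IsSmooth g → ∀ C : ℝ, 0 ≤ C → (∀ y, ‖g y‖ ≤ C) → ∀ y, ‖Torus.antidivergence g y‖ ≤ Kℛ * C)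
    (y : 𝕋³) :
    ‖Torus.perturbedStressV ν v (D.wW' s) (D.zetaW s) (D.S₁W s Rc) (D.ffunW s) t y‖ ≤
      2 * (ρc + (2 * (Sp * (Sw + Sp)) + (Sw + Sp) ^ 2) + SS) + 4 * (V₀ * Sw) + 4 * |ν| * (3 * Sd) +
        Kℛ * (Sf + S' * (Sp + Sc + 2 * SX)) := by
  obtain ⟨hs1, hs2, hs2'⟩ := weight_le_one h h01
  have hS'0 : 0 ≤ S' := (abs_nonneg _).trans hS'
  have _ := hRc
  have hw' : Torus.IsSmooth (D.wW' s t) := (smooth_wW' h hs).isSmooth_slice ht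
  have hff : Torus.IsSmooth (D.ffunW s t) := (smooth_ffunW h hs).isSmooth_slice ht
  have hSf0 : 0 ≤ Sf := le_trans (by positivity) (hSf y)
  have hV0 : 0 ≤ V₀ := (norm_nonneg _).trans (hV y)
  have hSw0 : 0 ≤ Sw := (norm_nonneg _).trans (hSw y)
  have hSp0 : 0 ≤ Sp := (norm_nonneg _).trans (hSp y)
  have hSc0 : 0 ≤ Sc := (norm_nonneg _).trans (hSc y)
  have hSX0 : 0 ≤ SX := (norm_nonneg _).trans (hSX y)
  have h0 := Torus.norm_perturbedStressV_le (ν := ν) (u := v) (w' := D.wW' s) (ζ := D.zetaW s) (S₁ := D.S₁W s Rc) (f := D.ffunW s) (t := t)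
    (hw'.isContDiff (by simp)) y
  have e1 : ‖Torus.incr (D.wW' s) (D.zetaW s) t y‖ = ‖D.wW s t y‖ := rfl
  rw [e1] at h0
  -- the pieces
  have hswp : ‖s t • D.wp t y‖ ≤ Sp := by
    rw [norm_smul, Real.norm_eq_abs]; exact (mul_le_mul_of_nonneg_right hs1 (norm_nonneg _)).trans (by rw [one_mul]; exact hSp y)
  have hwr : ‖D.wrW s t y‖ ≤ Sw + Sp := by
    show ‖D.wW s t y - s t • D.wp t y‖ ≤ _; exact (norm_sub_le _ _).trans (add_le_add (hSw y) hswp)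
  have hcross : ‖D.crossW s t y‖ ≤ 2 * (Sp * (Sw + Sp)) + (Sw + Sp) ^ 2 := by
    have e : D.crossW s t y = Torus.tensorProd (fun z => s t • D.wp t z) (D.wrW s t) y + Torus.tensorProd (D.wrW s t) (fun z => s t • D.wp t z) y +
        Torus.tensorProd (D.wrW s t) (D.wrW s t) y := by
      funext j; rfl
    rw [e]
    have hwr0 : 0 ≤ ‖D.wrW s t y‖ := norm_nonneg _
    calc _ ≤ ‖Torus.tensorProd (fun z => s t • D.wp t z) (D.wrW s t) y‖ + ‖Torus.tensorProd (D.wrW s t) (fun z => s t • D.wp t z) y‖ +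
          ‖Torus.tensorProd (D.wrW s t) (D.wrW s t) y‖ := (norm_add_le _ _).trans (add_le_add (norm_add_le _ _) le_rfl)
      _ ≤ ‖s t • D.wp t y‖ * ‖D.wrW s t y‖ + ‖D.wrW s t y‖ * ‖s t • D.wp t y‖ + ‖D.wrW s t y‖ * ‖D.wrW s t y‖ :=
          add_le_add (add_le_add (norm_tensorProd_le _ _ y) (norm_tensorProd_le _ _ y)) (norm_tensorProd_le _ _ y)
      _ ≤ Sp * (Sw + Sp) + (Sw + Sp) * Sp + (Sw + Sp) * (Sw + Sp) :=
          add_le_add (add_le_add (mul_le_mul hswp hwr hwr0 hSp0) (mul_le_mul hwr hswp (norm_nonneg _) (by linarith)))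
            (mul_le_mul hwr hwr hwr0 (by linarith))
      _ = _ := by ring
  have hS1 : ‖D.S₁W s Rc t y‖ ≤ ρc + (2 * (Sp * (Sw + Sp)) + (Sw + Sp) ^ 2) + SS := by
    have e : D.S₁W s Rc t y = Rc t y + D.crossW s t y + (s t) ^ 2 • D.Sosc t y := by funext j; rfl
    rw [e]
    have n3 : ‖(s t) ^ 2 • D.Sosc t y‖ ≤ SS := by
      rw [norm_smul, Real.norm_eq_abs]; exact (mul_le_mul_of_nonneg_right hs2' (norm_nonneg _)).trans (by rw [one_mul]; exact hSS y)
    exact (norm_add_le _ _).trans (add_le_add ((norm_add_le _ _).trans (add_le_add (hρ y) hcross)) n3)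
  have hsum : ∑ i, ‖Torus.partialDeriv i (D.wW' s t) y‖ ≤ 3 * Sd :=
    (Finset.sum_le_sum fun i _ => hSd i y).trans (le_of_eq (by simp only [Finset.sum_const, Finset.card_univ, Fintype.card_fin, nsmul_eq_mul, Nat.cast_ofNat]))
  -- the source: `‖f̃‖ ≤ Sf + S'(Sp + Sc + 2 SX)`
  have hffb : ∀ z, ‖D.ffunW s t z‖ ≤ Sf + S' * (Sp + Sc + 2 * SX) := by
    intro z
    have hwpc : ‖D.wpc t z‖ ≤ Sp + Sc := by
      have : D.wpc t z = D.wp t z + (D.wpc t z - D.wp t z) := by abel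
      rw [this]; exact (norm_add_le _ _).trans (add_le_add (hSp z) (hSc z))
    have h2s : |2 * s t * D.sdot s t| ≤ 2 * S' := by
      rw [abs_mul, abs_mul, abs_two]
      calc 2 * |s t| * |D.sdot s t| ≤ 2 * 1 * S' := mul_le_mul (mul_le_mul_of_nonneg_left hs1 (by norm_num)) hS' (abs_nonneg _) (by norm_num)
        _ = 2 * S' := by ring
    have n1 : ‖s t • D.f₁ t z‖ ≤ ‖D.f₁ t z‖ := by
      rw [norm_smul, Real.norm_eq_abs]; exact (mul_le_mul_of_nonneg_right hs1 (norm_nonneg _)).trans (by rw [one_mul])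
    have n2 : ‖(s t) ^ 2 • (D.f₂ t z + D.f₃ t z + D.f₄ t)‖ ≤ ‖D.f₂ t z‖ + ‖D.f₃ t z‖ + ‖D.f₄ t‖ := by
      rw [norm_smul, Real.norm_eq_abs]
      refine (mul_le_mul_of_nonneg_right hs2' (norm_nonneg _)).trans ?_
      rw [one_mul]; exact (norm_add_le _ _).trans (add_le_add (norm_add_le _ _) le_rfl)
    have n3 : ‖D.sdot s t • D.wpc t z‖ ≤ S' * (Sp + Sc) := by
      rw [norm_smul, Real.norm_eq_abs]; exact mul_le_mul hS' hwpc (norm_nonneg _) hS'0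
    have n4 : ‖(2 * s t * D.sdot s t) • D.X t z‖ ≤ (2 * S') * SX := by
      rw [norm_smul, Real.norm_eq_abs]; exact mul_le_mul h2s (hSX z) (norm_nonneg _) (by positivity)
    have e : D.ffunW s t z = s t • D.f₁ t z + (s t) ^ 2 • (D.f₂ t z + D.f₃ t z + D.f₄ t) + D.sdot s t • D.wpc t z +
        (2 * s t * D.sdot s t) • D.X t z := rfl
    rw [e]
    have t1 := norm_add_le (s t • D.f₁ t z + (s t) ^ 2 • (D.f₂ t z + D.f₃ t z + D.f₄ t) + D.sdot s t • D.wpc t z) ((2 * s t * D.sdot s t) • D.X t z)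
    have t2 := norm_add_le (s t • D.f₁ t z + (s t) ^ 2 • (D.f₂ t z + D.f₃ t z + D.f₄ t)) (D.sdot s t • D.wpc t z)
    have t3 := norm_add_le (s t • D.f₁ t z) ((s t) ^ 2 • (D.f₂ t z + D.f₃ t z + D.f₄ t))
    linarith [hSf z]
  have hR : ‖Torus.antidivergence (D.ffunW s t) y‖ ≤ Kℛ * (Sf + S' * (Sp + Sc + 2 * SX)) := hKℛ _ hff _ (by positivity) hffb y
  have hν : 0 ≤ 4 * |ν| := by positivity
  nlinarith [mul_le_mul_of_nonneg_left hS1 (by norm_num : (0:ℝ) ≤ 2), mul_le_mul (hV y) (hSw y) (norm_nonneg _) hV0,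
    mul_le_mul_of_nonneg_left hsum hν, norm_nonneg (v t y), norm_nonneg (D.wW s t y)]

end Sup


/-! ## The energy identity (BV 2019, §7 (7.3)–(7.6)) -/

section Energy

include hA

omit hs in
/-- **The energy of one jet term, two-sided**: `|∫ hsq_x η²ψ̃² - ∫ hsq_x| ≤ 3H₁√3 σ⁻¹` (improved Hölder with
`p = 1`, two-sided form). [cite: BuckmasterVicol2019Annals, §7 (7.5); BuckmasterVicol2020, §7.5.4 (7.40)] -/
theorem abs_integral_hsq_fastF_sub_le (x : Idx) {t : ℝ} (ht : t ∈ Icc 0 D.T) :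
    |(∫ y, JAmp.hsq D.γ₀ D.M x t y * Jet.fastF (D.J x) D.s x t y) - ∫ y, JAmp.hsq D.γ₀ D.M x t y| ≤ 3 * H₁ * (Real.sqrt 3 / D.σ) := by
  have hσpos : 0 < D.σ := h.hσ
  have hh : Torus.IsSmooth (JAmp.hsq D.γ₀ D.M x t) := (smooth_hsq h x).isSmooth_slice ht
  have hf : Torus.IsSmooth (Jet.fastF (D.J x) D.s x t) := (smooth_fastF h x).isSmooth_slice ht
  have hh0 : ∀ y, 0 ≤ JAmp.hsq D.γ₀ D.M x t y := fun y => (hsq_le h hA x ht y).1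
  have hf0 : ∀ y, 0 ≤ Jet.fastF (D.J x) D.s x t y := fun y => by unfold Jet.fastF; positivity
  have hL : ∀ z z' : E³, |JAmp.hsq D.γ₀ D.M x t (Torus.proj z) - JAmp.hsq D.γ₀ D.M x t (Torus.proj z')| ≤ (3 * H₁) * ‖z - z'‖ := by
    intro z z'
    have hlift : ∀ w, ‖fderiv ℝ (Torus.lift (JAmp.hsq D.γ₀ D.M x t)) w‖ ≤ ∑ _i : Fin 3, H₁ :=
      Torus.norm_fderiv_lift_le_of_norm_partialDeriv_le (hh.isContDiff (by simp)) (M := fun _ => H₁)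
        (fun i w => by rw [Real.norm_eq_abs]; exact hA.dh_le x t ht w i)
    have hdiff : Differentiable ℝ (Torus.lift (JAmp.hsq D.γ₀ D.M x t)) := hh.differentiable (by simp)
    have hmv := Convex.norm_image_sub_le_of_norm_fderiv_le (fun w _ => hdiff.differentiableAt) (fun w _ => hlift w) convex_univ
      (mem_univ z') (mem_univ z)
    rw [Torus.lift_apply, Torus.lift_apply, Real.norm_eq_abs] at hmv
    refine hmv.trans (le_of_eq ?_)
    simp [Finset.sum_const]
  have h1 := Torus.abs_integral_mul_sub_le_of_latticeInvariant (d := Fin 3) (N := D.σ) hσpos (by have := hA.hH₁; positivity)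
    (B := A₀ ^ 2) (f := JAmp.hsq D.γ₀ D.M x t) (g := Jet.fastF (D.J x) D.s x t)
    (fun y => by rw [abs_of_nonneg (hh0 y)]; exact (hsq_le h hA x ht y).2) hL hf0 hf.integrable
    (fun y κ' => fastF_latticeInvariant h x t y κ')
  rw [Jet.integral_fastF D.s (Jvalid h x) hd3 x t, mul_one, mul_one] at h1
  simpa using h1

omit hs in
/-- **`∑_x |k_x|² hsq_x = 3ρ - tr M`** pointwise (the geometric lemma, traced). [cite: BuckmasterVicol2020, §7.5.1 (7.30)] -/
theorem sum_hsq_mul_dirNormSq {t : ℝ} (ht : t ∈ Icc 0 D.T) (y : 𝕋³) :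
    ∑ x, JAmp.hsq D.γ₀ D.M x t y * dirNormSq x = 3 * JAmp.rho D.γ₀ D.M t y - Torus.tensorTrace (D.M t) y := by
  have _ := hA
  have hsym : ∀ i j, D.M t y i j = D.M t y j i := fun i j => h.hMsym t ht y i j
  have key := fun a => JAmp.sum_hsq_mul_dir (γ₀ := D.γ₀) (R := D.M) hd3 h.hγ hsym a a
  calc ∑ x, JAmp.hsq D.γ₀ D.M x t y * dirNormSq x = ∑ x, ∑ a, JAmp.hsq D.γ₀ D.M x t y * (((dir x a : ℤ) : ℝ) * ((dir x a : ℤ) : ℝ)) := by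
        refine Finset.sum_congr rfl fun x _ => ?_
        rw [← sum_sq_dir x, Finset.mul_sum]
        exact Finset.sum_congr rfl fun a _ => by ring
    _ = ∑ a : Fin 3, (JAmp.rho D.γ₀ D.M t y * (if a = a then 1 else 0) - D.M t y a a) := by rw [Finset.sum_comm]; exact Finset.sum_congr rfl fun a _ => key a
    _ = 3 * JAmp.rho D.γ₀ D.M t y - Torus.tensorTrace (D.M t) y := by
        simp only [if_true, mul_one, Finset.sum_sub_distrib, Finset.sum_const, Finset.card_univ, Fintype.card_fin, nsmul_eq_mul, Nat.cast_ofNat]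
        rfl

omit hs in
/-- **The energy of `w^{(p)}`, two-sided**: `|∫‖wp‖² - ∫(3ρ - tr M)| ≤ 5N · 3H₁√3σ⁻¹`.
[cite: BuckmasterVicol2019Annals, §7 (7.5)–(7.6); BuckmasterVicol2020, §7.5.4 (7.40)] -/
theorem abs_integral_norm_wp_sq_sub_le {t : ℝ} (ht : t ∈ Icc 0 D.T) :
    |(∫ y, ‖D.wp t y‖ ^ 2) - ∫ y, (3 * JAmp.rho D.γ₀ D.M t y - Torus.tensorTrace (D.M t) y)| ≤ NN * (5 * (3 * H₁ * (Real.sqrt 3 / D.σ))) := by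
  have hF : ∀ x, Continuous fun y => D.F x t y := fun x => (isSmooth_F h x ht).continuous
  have hh : ∀ x, Continuous fun y => JAmp.hsq D.γ₀ D.M x t y := fun x => ((smooth_hsq h x).isSmooth_slice ht).continuous
  have e1 : ∫ y, ‖D.wp t y‖ ^ 2 = ∑ x, dirNormSq x * ∫ y, D.F x t y := by
    calc ∫ y, ‖D.wp t y‖ ^ 2 = ∫ y, ∑ x, D.F x t y * dirNormSq x := integral_congr_ae (Eventually.of_forall fun y => norm_wp_sq h t y)
      _ = ∑ x, dirNormSq x * ∫ y, D.F x t y := by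
          rw [integral_finsetSum _ fun x _ =>
            (show Integrable (fun y => D.F x t y * dirNormSq x) volume from ((hF x).mul continuous_const).integrable_unitAddTorus)]
          exact Finset.sum_congr rfl fun x _ => by
            rw [← integral_const_mul]; exact integral_congr_ae (Eventually.of_forall fun y => by simp only; ring)
  have e2 : ∫ y, (3 * JAmp.rho D.γ₀ D.M t y - Torus.tensorTrace (D.M t) y) = ∑ x, dirNormSq x * ∫ y, JAmp.hsq D.γ₀ D.M x t y := by
    calc ∫ y, (3 * JAmp.rho D.γ₀ D.M t y - Torus.tensorTrace (D.M t) y) = ∫ y, ∑ x, JAmp.hsq D.γ₀ D.M x t y * dirNormSq x :=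
          integral_congr_ae (Eventually.of_forall fun y => (sum_hsq_mul_dirNormSq h hA ht y).symm)
      _ = ∑ x, dirNormSq x * ∫ y, JAmp.hsq D.γ₀ D.M x t y := by
          rw [integral_finsetSum _ fun x _ =>
            (show Integrable (fun y => JAmp.hsq D.γ₀ D.M x t y * dirNormSq x) volume from ((hh x).mul continuous_const).integrable_unitAddTorus)]
          exact Finset.sum_congr rfl fun x _ => by
            rw [← integral_const_mul]; exact integral_congr_ae (Eventually.of_forall fun y => by simp only; ring)
  rw [e1, e2, ← Finset.sum_sub_distrib]
  refine (Finset.abs_sum_le_sum_abs _ _).trans (sum_le_NN_mul fun x => ?_)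
  have hFx : ∫ y, D.F x t y = ∫ y, JAmp.hsq D.γ₀ D.M x t y * Jet.fastF (D.J x) D.s x t y :=
    integral_congr_ae (Eventually.of_forall fun y => by show D.F x t y = _; rw [F, a_sq h])
  rw [← mul_sub, abs_mul, abs_of_pos (dirNormSq_pos x), hFx]
  exact mul_le_mul (dirNormSq_le' x) (abs_integral_hsq_fastF_sub_le h hA x ht) (abs_nonneg _) (by norm_num)

omit hA hs in
/-- **`|∫(3ρ - tr M) - 6γ₀/r| ≤ (18/r + 3)∫‖M‖`** (`2γ₀/r ≤ ρ ≤ (2/r)(γ₀ + 3‖M‖)`, `|tr M| ≤ 3‖M‖`). [folklore] -/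
theorem abs_integral_rho_trace_sub_le {t : ℝ} (ht : t ∈ Icc 0 D.T) :
    |(∫ y, (3 * JAmp.rho D.γ₀ D.M t y - Torus.tensorTrace (D.M t) y)) - 6 * D.γ₀ / radius (Fin 3)| ≤
      (18 / radius (Fin 3) + 3) * ∫ y, ‖D.M t y‖ := by
  have hr := radius_pos hd3
  have hM : Torus.IsSmooth (D.M t) := h.hM.isSmooth_slice ht
  have hρc : Continuous (JAmp.rho D.γ₀ D.M t) := ((JAmp.isSmoothSpaceTimeOn_rho h.hγ h.hM).isSmooth_slice ht).continuous
  have htr : Continuous (Torus.tensorTrace (D.M t)) := hM.tensorTrace.continuous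
  have hpt : ∀ y, |3 * JAmp.rho D.γ₀ D.M t y - Torus.tensorTrace (D.M t) y - 6 * D.γ₀ / radius (Fin 3)| ≤ (18 / radius (Fin 3) + 3) * ‖D.M t y‖ := by
    intro y
    have h1 := JAmp.le_rho (R := D.M) hd3 h.hγ t y
    have h2 := JAmp.rho_le_norm (R := D.M) hd3 h.hγ t y
    have h3 : |Torus.tensorTrace (D.M t) y| ≤ 3 * ‖D.M t y‖ := by
      unfold Torus.tensorTrace
      refine (Finset.abs_sum_le_sum_abs _ _).trans ?_
      calc ∑ i, |D.M t y i i| ≤ ∑ _i : Fin 3, ‖D.M t y‖ := Finset.sum_le_sum fun i _ => by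
            rw [← Real.norm_eq_abs]; exact (PiLp.norm_apply_le (D.M t y i) i).trans (norm_le_pi_norm _ i)
        _ = 3 * ‖D.M t y‖ := by simp only [Finset.sum_const, Finset.card_univ, Fintype.card_fin, nsmul_eq_mul, Nat.cast_ofNat]
    have h2' : 3 * JAmp.rho D.γ₀ D.M t y - 6 * D.γ₀ / radius (Fin 3) ≤ 18 / radius (Fin 3) * ‖D.M t y‖ := by
      have : (Fintype.card (Fin 3) : ℝ) = 3 := by simp
      rw [this] at h2
      have e : 3 * (2 / radius (Fin 3) * (D.γ₀ + 3 * ‖D.M t y‖)) = 6 * D.γ₀ / radius (Fin 3) + 18 / radius (Fin 3) * ‖D.M t y‖ := by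
        field_simp; ring
      linarith [e]
    have h1' : 6 * D.γ₀ / radius (Fin 3) ≤ 3 * JAmp.rho D.γ₀ D.M t y := by
      have e : 6 * D.γ₀ / radius (Fin 3) = 3 * (2 * D.γ₀ / radius (Fin 3)) := by ring
      rw [e]; linarith
    have h3' := abs_le.1 h3
    have hn : 0 ≤ 18 / radius (Fin 3) * ‖D.M t y‖ := by positivity
    rw [abs_le]; constructor <;> nlinarith [h3'.1, h3'.2]
  have hint : Integrable (fun y => 3 * JAmp.rho D.γ₀ D.M t y - Torus.tensorTrace (D.M t) y) volume := ((hρc.const_mul 3).sub htr).integrable_unitAddTorus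
  calc |(∫ y, (3 * JAmp.rho D.γ₀ D.M t y - Torus.tensorTrace (D.M t) y)) - 6 * D.γ₀ / radius (Fin 3)|
      = |∫ y, (3 * JAmp.rho D.γ₀ D.M t y - Torus.tensorTrace (D.M t) y - 6 * D.γ₀ / radius (Fin 3))| := by
        rw [integral_sub hint (integrable_const _), integral_const, smul_eq_mul, probReal_univ, one_mul]
    _ ≤ ∫ y, |3 * JAmp.rho D.γ₀ D.M t y - Torus.tensorTrace (D.M t) y - 6 * D.γ₀ / radius (Fin 3)| := abs_integral_le_integral_abs
    _ ≤ ∫ y, (18 / radius (Fin 3) + 3) * ‖D.M t y‖ :=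
        integral_mono (hint.sub (integrable_const _)).abs ((hM.continuous.norm).const_mul _).integrable_unitAddTorus hpt
    _ = (18 / radius (Fin 3) + 3) * ∫ y, ‖D.M t y‖ := integral_const_mul _ _

include hs in
/-- **The energy identity of the weighted step** (BV 2019, §7 (7.3)–(7.6)): for `0 ≤ s ≤ 1`,
`|∫‖v + w̃‖² - ∫‖v‖² - s²∫(3ρ - tr M)| ≤ 2V₀(L_p + L_c + √E_X + √E_ζ) + (2√(E_p E_r) + E_r) + 5N·3H₁√3σ⁻¹`
(`‖v + w̃‖² = ‖v‖² + 2⟪v, w̃⟫ + ‖w̃‖²`, `‖w̃‖² = s²‖wp‖² + 2s⟪wp, w̃r⟫ + ‖w̃r‖²`).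
[cite: BuckmasterVicol2019Annals, §7 (7.3)–(7.6)] -/
theorem abs_energy_sub_le {v : ℝ → 𝕋³ → E³} {t : ℝ} (ht : t ∈ Icc 0 D.T) (hvc : Continuous (v t)) (h01 : 0 ≤ s t ∧ s t ≤ 1)
    {V₀ Ep Sc Lc EX Eζ Lp : ℝ} (hV : ∀ y, ‖v t y‖ ≤ V₀)
    (hEp : ∫ y, ‖D.wp t y‖ ^ 2 ≤ Ep) (hLp : ∫ y, ‖D.wp t y‖ ≤ Lp)
    (hSc : ∀ y, ‖D.wpc t y - D.wp t y‖ ≤ Sc) (hLc : ∫ y, ‖D.wpc t y - D.wp t y‖ ≤ Lc)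
    (hEX : ∫ y, ‖D.X t y‖ ^ 2 ≤ EX) (hEζ : ∫ y, ‖Torus.gradient (D.zeta t) y‖ ^ 2 ≤ Eζ) :
    |(∫ y, ‖v t y + D.wW s t y‖ ^ 2) - (∫ y, ‖v t y‖ ^ 2) - (s t) ^ 2 * ∫ y, (3 * JAmp.rho D.γ₀ D.M t y - Torus.tensorTrace (D.M t) y)| ≤
      2 * V₀ * (Lp + Lc + Real.sqrt EX + Real.sqrt Eζ) + (2 * (Real.sqrt Ep * Real.sqrt (3 * (Sc * Lc + EX + Eζ))) + 3 * (Sc * Lc + EX + Eζ)) +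
        NN * (5 * (3 * H₁ * (Real.sqrt 3 / D.σ))) := by
  obtain ⟨hs1, hs2, hs2'⟩ := weight_le_one h h01
  have hV0 : 0 ≤ V₀ := (norm_nonneg _).trans (hV (Classical.arbitrary _))
  have hwp := isSmooth_wp h ht
  have hw : Torus.IsSmooth (D.wW s t) := (smooth_wW h hs).isSmooth_slice ht
  have hwr := isSmooth_wrW h hs ht
  have hEr := integral_norm_wrW_sq_le h hs ht h01 hSc hLc hEX hEζ
  have hIw := integral_norm_wW_le h hs ht h01 hLp hLc hEX hEζ
  -- pointwise expansions
  have ex1 : ∀ y, ‖v t y + D.wW s t y‖ ^ 2 = ‖v t y‖ ^ 2 + 2 * ⟪v t y, D.wW s t y⟫_ℝ + ‖D.wW s t y‖ ^ 2 := fun y => norm_add_sq_real _ _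
  have ex2 : ∀ y, ‖D.wW s t y‖ ^ 2 = (s t) ^ 2 * ‖D.wp t y‖ ^ 2 + 2 * (s t * ⟪D.wp t y, D.wrW s t y⟫_ℝ) + ‖D.wrW s t y‖ ^ 2 := by
    intro y
    have e : D.wW s t y = s t • D.wp t y + D.wrW s t y := by simp [wrW]
    rw [e, norm_add_sq_real, norm_smul, mul_pow, Real.norm_eq_abs, sq_abs, real_inner_smul_left]
  -- integrability
  have cv : Continuous fun y => ‖v t y‖ ^ 2 := hvc.norm.pow 2
  have ci : Continuous fun y => 2 * ⟪v t y, D.wW s t y⟫_ℝ := (hvc.inner hw.continuous).const_mul 2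
  have cw : Continuous fun y => ‖D.wW s t y‖ ^ 2 := hw.continuous.norm.pow 2
  have cp : Continuous fun y => (s t) ^ 2 * ‖D.wp t y‖ ^ 2 := (hwp.continuous.norm.pow 2).const_mul _
  have cpr : Continuous fun y => 2 * (s t * ⟪D.wp t y, D.wrW s t y⟫_ℝ) := ((hwp.continuous.inner hwr.continuous).const_mul _).const_mul 2
  have cr : Continuous fun y => ‖D.wrW s t y‖ ^ 2 := hwr.continuous.norm.pow 2
  have i12 : Integrable (fun y => ‖v t y‖ ^ 2 + 2 * ⟪v t y, D.wW s t y⟫_ℝ) volume := (cv.add ci).integrable_unitAddTorus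
  have j12 : Integrable (fun y => (s t) ^ 2 * ‖D.wp t y‖ ^ 2 + 2 * (s t * ⟪D.wp t y, D.wrW s t y⟫_ℝ)) volume := (cp.add cpr).integrable_unitAddTorus
  have I1 : ∫ y, ‖v t y + D.wW s t y‖ ^ 2 = (∫ y, ‖v t y‖ ^ 2) + (∫ y, 2 * ⟪v t y, D.wW s t y⟫_ℝ) + ∫ y, ‖D.wW s t y‖ ^ 2 := by
    rw [integral_congr_ae (Eventually.of_forall ex1), integral_add i12 cw.integrable_unitAddTorus,
      integral_add cv.integrable_unitAddTorus ci.integrable_unitAddTorus]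
  have I2 : ∫ y, ‖D.wW s t y‖ ^ 2 = (s t) ^ 2 * (∫ y, ‖D.wp t y‖ ^ 2) + (∫ y, 2 * (s t * ⟪D.wp t y, D.wrW s t y⟫_ℝ)) + ∫ y, ‖D.wrW s t y‖ ^ 2 := by
    rw [integral_congr_ae (Eventually.of_forall ex2), integral_add j12 cr.integrable_unitAddTorus,
      integral_add cp.integrable_unitAddTorus cpr.integrable_unitAddTorus, integral_const_mul]
  -- the three error terms
  have b1 : |∫ y, 2 * ⟪v t y, D.wW s t y⟫_ℝ| ≤ 2 * V₀ * (Lp + Lc + Real.sqrt EX + Real.sqrt Eζ) := by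
    rw [integral_const_mul, abs_mul, abs_two, mul_assoc]
    refine mul_le_mul_of_nonneg_left ?_ (by norm_num)
    calc |∫ y, ⟪v t y, D.wW s t y⟫_ℝ| ≤ ∫ y, |⟪v t y, D.wW s t y⟫_ℝ| := abs_integral_le_integral_abs
      _ ≤ ∫ y, V₀ * ‖D.wW s t y‖ := integral_mono (hvc.inner hw.continuous).abs.integrable_unitAddTorus
          (hw.continuous.norm.const_mul _).integrable_unitAddTorus fun y =>
            (abs_real_inner_le_norm _ _).trans (mul_le_mul_of_nonneg_right (hV y) (norm_nonneg _))
      _ ≤ V₀ * (Lp + Lc + Real.sqrt EX + Real.sqrt Eζ) := by rw [integral_const_mul]; exact mul_le_mul_of_nonneg_left hIw hV0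
  have b2 : |∫ y, 2 * (s t * ⟪D.wp t y, D.wrW s t y⟫_ℝ)| ≤ 2 * (Real.sqrt Ep * Real.sqrt (3 * (Sc * Lc + EX + Eζ))) := by
    rw [integral_const_mul, abs_mul, abs_two]
    refine mul_le_mul_of_nonneg_left ?_ (by norm_num)
    calc |∫ y, s t * ⟪D.wp t y, D.wrW s t y⟫_ℝ| ≤ ∫ y, |s t * ⟪D.wp t y, D.wrW s t y⟫_ℝ| := abs_integral_le_integral_abs
      _ ≤ ∫ y, ‖D.wp t y‖ * ‖D.wrW s t y‖ := integral_mono ((hwp.continuous.inner hwr.continuous).const_mul _).abs.integrable_unitAddTorus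
          (hwp.continuous.norm.mul hwr.continuous.norm).integrable_unitAddTorus fun y => by
            rw [abs_mul]
            calc |s t| * |⟪D.wp t y, D.wrW s t y⟫_ℝ| ≤ 1 * (‖D.wp t y‖ * ‖D.wrW s t y‖) :=
                  mul_le_mul hs1 (abs_real_inner_le_norm _ _) (abs_nonneg _) (by norm_num)
              _ = _ := one_mul _
      _ ≤ Real.sqrt Ep * Real.sqrt (3 * (Sc * Lc + EX + Eζ)) := integral_norm_mul_norm_le hwp.continuous hwr.continuous hEp hEr
  have b3 := abs_integral_norm_wp_sq_sub_le h hA ht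
  have hEp0 : 0 ≤ ∫ y, ‖D.wp t y‖ ^ 2 := integral_nonneg fun _ => sq_nonneg _
  have hQabs : |(s t) ^ 2 * (∫ y, ‖D.wp t y‖ ^ 2) - (s t) ^ 2 * ∫ y, (3 * JAmp.rho D.γ₀ D.M t y - Torus.tensorTrace (D.M t) y)| ≤
      NN * (5 * (3 * H₁ * (Real.sqrt 3 / D.σ))) := by
    rw [← mul_sub, abs_mul]
    calc |(s t) ^ 2| * |(∫ y, ‖D.wp t y‖ ^ 2) - ∫ y, (3 * JAmp.rho D.γ₀ D.M t y - Torus.tensorTrace (D.M t) y)|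
        ≤ 1 * (NN * (5 * (3 * H₁ * (Real.sqrt 3 / D.σ)))) := mul_le_mul hs2' b3 (abs_nonneg _) (by norm_num)
      _ = _ := one_mul _
  have hr0 : 0 ≤ ∫ y, ‖D.wrW s t y‖ ^ 2 := integral_nonneg fun _ => sq_nonneg _
  rw [I1, I2]
  have hb1 := abs_le.1 b1; have hb2 := abs_le.1 b2; have hq := abs_le.1 hQabs
  rw [abs_le]; constructor <;> linarith

end Energy

end Datum


/-! ## The weighted step -/

set_option maxHeartbeats 4000000 in
/-- **The time-weighted jet step for Navier–Stokes–Reynolds triples** (BV, Ann. of Math. 2019, §7, in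
the jet scheme of BV §7.5–7.7, with symbolic parameters). Given a classical NSR triple
`(v, p, R_c + s² N̊)` on `[0,T]` (a smooth symmetric `N` with the displayed `ℓ⁻¹`-losses, a smooth weight
`0 ≤ s ≤ 1` with `|s'| ≤ S'`), the perturbed velocity `v' = v + w̃`, `w̃ = s(w^{(p)} + w^{(c)}) + s² w^{(t)}`
(jets built on `N` with floor `γ₀`), solves a classical NSR system whose stress obeys the `L¹`/sup bounds of
`JetStep.jet_step` plus `2 sup‖R_c‖` and the cut-off terms, `v'` obeys the `C⁰/C¹/∂ₜ` bounds, the ENERGY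
obeys `∫|v'|² = ∫|v|² + s² ∫(3ρ - tr N) + O(errors)` with `|∫(3ρ - tr N) - 6γ₀/r| ≤ (18/r + 3)∫‖N‖`, and
where `s = s' = 0` nothing changes: `v' = v`, `R' = R̊_c`.
[cite: BuckmasterVicol2019Annals, Prop. 2.1, §7 (7.3)–(7.6); BuckmasterVicol2020, §7.5–7.7] -/
theorem jet_step_weighted : ∃ c : StepConsts, c.Valid ∧ c.Cp = 1 ∧
    ∀ (P : StepPars) (ν : ℝ) (v : ℝ → 𝕋³ → E³) (p : ℝ → 𝕋³ → ℝ) (Rc N : ℝ → 𝕋³ → Fin 3 → E³) (s : ℝ → ℝ) (ρc S' : ℝ),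
    P.Valid → 0 < ν → ν ≤ 1 →
    Torus.IsSmoothSpaceTimeOn (Icc 0 P.T) N → (∀ t ∈ Icc 0 P.T, ∀ y, ∀ i j : Fin 3, N t y i j = N t y j i) →
    ContDiffOn ℝ ∞ s (Icc 0 P.T) → (∀ t ∈ Icc 0 P.T, 0 ≤ s t ∧ s t ≤ 1) → (∀ t ∈ Icc 0 P.T, |derivWithin s (Icc 0 P.T) t| ≤ S') →
    Torus.IsNSReynoldsOn (Icc 0 P.T) ν v p (fun t y j => Rc t y j + (s t) ^ 2 • Torus.traceless (N t) y j) →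
    (∀ t ∈ Icc 0 P.T, Torus.HasZeroMean (v t)) →
    Torus.IsSmoothSpaceTimeOn (Icc 0 P.T) Rc → (∀ t ∈ Icc 0 P.T, ∀ y, ∀ i j : Fin 3, Rc t y i j = Rc t y j i) →
    (∀ t ∈ Icc 0 P.T, ∀ y, ‖v t y‖ ≤ P.V) → (∀ i, ∀ t ∈ Icc 0 P.T, ∀ y, ‖Torus.partialDeriv i (v t) y‖ ≤ P.V) →
    (∀ t ∈ Icc 0 P.T, ∀ y, ‖Torus.timeDerivWithin (Icc 0 P.T) v t y‖ ≤ P.V) →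
    (∀ t ∈ Icc 0 P.T, ∀ y, ‖Rc t y‖ ≤ ρc) →
    (∀ t ∈ Icc 0 P.T, ∀ y, ‖N t y‖ ≤ P.A) → (∀ t ∈ Icc 0 P.T, ∀ y l, ‖Torus.partialDeriv l (N t) y‖ ≤ P.A * P.ℓ⁻¹) →
    (∀ t ∈ Icc 0 P.T, ∀ y, ‖Torus.timeDerivWithin (Icc 0 P.T) N t y‖ ≤ P.A * P.ℓ⁻¹) →
    (∀ t ∈ Icc 0 P.T, ∀ y l m, ‖Torus.partialDeriv m (Torus.partialDeriv l (N t)) y‖ ≤ P.A * P.ℓ⁻¹ ^ 2) →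
    (∀ t ∈ Icc 0 P.T, ∀ y l, ‖Torus.timeDerivWithin (Icc 0 P.T) (fun s z => Torus.partialDeriv l (N s) z) t y‖ ≤ P.A * P.ℓ⁻¹ ^ 2) →
    (∀ t ∈ Icc 0 P.T, ∫ y, ‖N t y‖ ≤ P.δ) →
    ∃ (v' : ℝ → 𝕋³ → E³) (p' : ℝ → 𝕋³ → ℝ) (R' : ℝ → 𝕋³ → Fin 3 → E³),
      Torus.IsNSReynoldsOn (Icc 0 P.T) ν v' p' R' ∧ (∀ t ∈ Icc 0 P.T, Torus.HasZeroMean (v' t)) ∧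
      (∀ t ∈ Icc 0 P.T, eLpNorm (v' t - v t) 2 volume ≤ ENNReal.ofReal (Real.sqrt (P.Ep c) + Real.sqrt (P.Er c))) ∧
      (∀ t ∈ Icc 0 P.T, ∫ y, ‖R' t y‖ ≤ 2 * ρc + P.stepL1 c + S' * (c.C₁ * (P.Lp c + P.Lc c + 2 * Real.sqrt (P.EX c)))) ∧
      (∀ t ∈ Icc 0 P.T, ∀ y, ‖R' t y‖ ≤ 2 * ρc + P.stepSup c + c.Kℛ * (S' * (P.Sp c + P.Sc c + 2 * P.D.XSup (P.A₀ c) c.B))) ∧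
      (∀ t ∈ Icc 0 P.T, ∀ y, ‖v' t y‖ ≤ P.stepC0 c) ∧
      (∀ t ∈ Icc 0 P.T, ∀ y i, ‖Torus.partialDeriv i (v' t) y‖ ≤ P.stepC1 c) ∧
      (∀ t ∈ Icc 0 P.T, ∀ y, ‖Torus.timeDerivWithin (Icc 0 P.T) v' t y‖ ≤ P.stepCt c + S' * (2 * P.Sw c)) ∧
      (∀ t ∈ Icc 0 P.T, |(∫ y, ‖v' t y‖ ^ 2) - (∫ y, ‖v t y‖ ^ 2) -
          (s t) ^ 2 * ∫ y, (3 * JAmp.rho P.γ₀ N t y - Torus.tensorTrace (N t) y)| ≤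
        2 * P.V * (P.Lp c + P.Lc c + Real.sqrt (P.EX c) + Real.sqrt (P.Eζ c)) + (2 * (Real.sqrt (P.Ep c) * Real.sqrt (P.Er c)) + P.Er c) +
          NN * (5 * (3 * P.H₁ c * (Real.sqrt 3 / P.σ)))) ∧
      (∀ t ∈ Icc 0 P.T, |(∫ y, (3 * JAmp.rho P.γ₀ N t y - Torus.tensorTrace (N t) y)) - 6 * P.γ₀ / radius (Fin 3)| ≤
        (18 / radius (Fin 3) + 3) * ∫ y, ‖N t y‖) ∧
      (∀ t ∈ Icc 0 P.T, s t = 0 → derivWithin s (Icc 0 P.T) t = 0 → v' t = v t ∧ R' t = Torus.traceless (Rc t)) := by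
  -- the absolute constants
  obtain ⟨gfam, hgb, hg1, -⟩ := Intermittent.exists_isBump_disjoint (Fin 1)
  set g : ℝ → ℝ := gfam 0 with hgdef
  have hg : Intermittent.IsBump g := hgb 0
  have hgn : ∫ s in (0 : ℝ)..1, g s ^ 2 = 1 := hg1 0
  obtain ⟨B, hB1, hBall⟩ := Jet.exists_bounds hg
  obtain ⟨Cψ, hCψ1, hCψ⟩ := Jet.exists_ddpsi_const
  obtain ⟨C₂, hC₂⟩ := FunctionSpaces.Torus.eLpNorm_hessian_le_laplacian_holds (d := Fin 3) 2 (by norm_num) (by norm_num)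
  obtain ⟨K, hK⟩ := FunctionSpaces.Torus.exists_enorm_partialDeriv_partialDeriv_le (d := Fin 3)
  obtain ⟨K₁, hK₁⟩ := FunctionSpaces.Torus.exists_enorm_partialDeriv_invLaplacian_le (d := Fin 3)
  obtain ⟨C₁, hC₁⟩ := Torus.exists_eLpNorm_antidivergence_le (d := Fin 3) Datum.hd3 (p := 1) le_rfl
  have hp33 : (1 : ℝ≥0∞) < ENNReal.ofReal (33 / 32) := by
    rw [← ENNReal.ofReal_one]; exact (ENNReal.ofReal_lt_ofReal_iff (by norm_num)).2 (by norm_num)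
  obtain ⟨Cℛ, hCℛ⟩ := Torus.exists_eLpNorm_antidivergence_tensorDivergence_le (d := Fin 3) Datum.hd3 hp33 ENNReal.ofReal_lt_top
  obtain ⟨Kℛ, hKℛ0, hKℛ⟩ := Torus.exists_norm_antidivergence_le (d := Fin 3) Datum.hd3
  set c : StepConsts := ⟨1, JAmp.ampConst (Fin 3), B, Cψ, C₂, K, K₁, C₁, Cℛ, Kℛ⟩ with hcdef
  have hCa0 : 0 ≤ JAmp.ampConst (Fin 3) := by
    have := radius_pos Datum.hd3 (d := Fin 3); unfold JAmp.ampConst; positivity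
  refine ⟨c, ⟨le_rfl, hCa0, hB1, by linarith, C₂.coe_nonneg, K.coe_nonneg, K₁.coe_nonneg, C₁.coe_nonneg, Cℛ.coe_nonneg, hKℛ0⟩, rfl, ?_⟩
  intro P ν v p Rc N s ρc S' hP hν hν1 hN hNsym hs hs01 hS' hold hmean hRc hRcsym hv hdv htv hρ hNA hN1 hNt hN2 hNt1 hNδ
  obtain ⟨hT, hV1, hA1, hδ, hγ, hℓ, hℓ4, hℓT, hσ, hκ1, hμ60, hmup⟩ := hP
  have hV0 : 0 ≤ P.V := by linarith
  -- the datum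
  set D : Datum := ⟨P.T, P.γ₀, N, P.μ, P.κ, P.σ, P.mup, g⟩ with hDdef
  have hD : D.Valid := ⟨hT, hγ, hN, hNsym, hμ60, hκ1, hσ, hmup, hg, hgn⟩
  have hBD : ∀ x t, Jet.Bounds B (D.J x) D.s x t := fun x t => hBall (D.J x) rfl (Datum.Jvalid hD x) D.s x t
  have hCψD : ∀ (x : Idx) (i l : Fin 3) (y : 𝕋³), |Torus.partialDeriv i (Torus.partialDeriv l (Jet.psiJ (D.J x) D.s x)) y| ≤ Cψ * (D.σ : ℝ) ^ 2 * D.μ ^ 3 :=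
    fun x i l y => Jet.abs_partialDeriv_partialDeriv_psiJ_le D.s (Datum.Jvalid hD x) hCψ x i l y
  have hsD : ContDiffOn ℝ ∞ s (Icc 0 D.T) := hs
  -- the amplitude bounds
  set Y : ℝ := max 1 (1 * P.A / P.γ₀) with hYdef
  set Θ : ℝ := P.ℓ⁻¹ with hΘdef
  have hY1 : 1 ≤ Y := le_max_left _ _
  have hΘ1 : 1 ≤ Θ := by rw [hΘdef]; exact one_le_inv_iff₀.2 ⟨hℓ, by linarith⟩
  have hA0' : 0 ≤ P.A := by linarith
  have hD0 : P.A ≤ P.γ₀ * Y := by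
    have : 1 * P.A / P.γ₀ ≤ Y := le_max_right _ _
    rw [div_le_iff₀ hγ] at this; linarith
  have hℓinv : 0 < P.ℓ⁻¹ := inv_pos.2 hℓ
  have hD1 : P.A * P.ℓ⁻¹ ≤ P.γ₀ * Y * Θ := by rw [hΘdef]; exact mul_le_mul_of_nonneg_right hD0 hℓinv.le
  have hD2 : P.A * P.ℓ⁻¹ ^ 2 ≤ P.γ₀ * Y * Θ ^ 2 := by rw [hΘdef]; exact mul_le_mul_of_nonneg_right hD0 (by positivity)
  have hpack := fun x {t} (ht : t ∈ Icc 0 P.T) y l m => JAmp.jamp_package (d := Fin 3) (γ₀ := P.γ₀) (R := N) Datum.hd3 hγ hN (Datum.uniqueDiffOn hD)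
    hY1 hΘ1 hA0' (by positivity) (by positivity) hD0 hD1 hD2 hNA hN1 hNt hN2 hNt1 x ht y l m
  set A₀ : ℝ := JAmp.ampConst (Fin 3) * Real.sqrt (P.γ₀ * Y) with hA₀def
  set A₁ : ℝ := JAmp.ampConst (Fin 3) * Real.sqrt P.γ₀ * Y ^ 2 * Θ with hA₁def
  set A₂ : ℝ := JAmp.ampConst (Fin 3) * Real.sqrt P.γ₀ * Y ^ 4 * Θ ^ 2 with hA₂def
  set H₁ : ℝ := JAmp.ampConst (Fin 3) * P.γ₀ * Y ^ 2 * Θ with hH₁def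
  set H₂ : ℝ := JAmp.ampConst (Fin 3) * P.γ₀ * Y ^ 4 * Θ ^ 2 with hH₂def
  have hY0 : 0 ≤ Y := by linarith
  have hΘ0 : 0 ≤ Θ := by linarith
  have hγ0 : 0 ≤ P.γ₀ := hγ.le
  have hAmp : D.AmpBounds A₀ A₁ A₂ H₁ H₂ := by
    refine ⟨by positivity, by positivity, by positivity, by positivity, by positivity, ?_, ?_, ?_, ?_, ?_, ?_, ?_, ?_, ?_⟩
    · intro x t ht y
      have h0 := (hpack x ht y 0 0).1
      show |JAmp.jamp P.γ₀ N x t y| ≤ A₀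
      rw [abs_of_nonneg h0.1]; exact h0.2
    · intro x t ht y l; exact (hpack x ht y l 0).2.1
    · intro x t ht y; exact (hpack x ht y 0 0).2.2.1
    · intro x t ht y l m; exact (hpack x ht y l m).2.2.2.1
    · intro x t ht y l; exact (hpack x ht y l 0).2.2.2.2.1
    · intro x t ht y l; exact (hpack x ht y l 0).2.2.2.2.2.1
    · intro x t ht y; exact (hpack x ht y 0 0).2.2.2.2.2.2.1
    · intro x t ht y l m; exact (hpack x ht y l m).2.2.2.2.2.2.2.1
    · intro x t ht y l; exact (hpack x ht y l 0).2.2.2.2.2.2.2.2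
  have hAmp0 : 0 ≤ A₀ := hAmp.hA₀
  have hC₂' : ∀ w : 𝕋³ → ℝ, Torus.IsSmooth w → ∀ j k : Fin 3,
      eLpNorm (Torus.partialDeriv j (Torus.partialDeriv k w)) 2 volume ≤ C₂ * eLpNorm (Torus.laplacian w) 2 volume := hC₂
  -- the new triple
  have hnew := Datum.isNSReynoldsOn_newW hD hsD (ν := ν) (v := v) (P := p) (Rc := Rc) hold hRc hRcsym
  have hvS : Torus.IsSmoothSpaceTimeOn (Icc 0 P.T) v := hold.smooth_velocity
  -- `sup|η²ψ̃² - 1|`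
  have hfastF : ∀ x t y, Jet.fastF (D.J x) D.s x t y ≤ D.fastSup B := by
    intro x t y
    obtain ⟨e0, -, -, p0, -⟩ := Datum.factor_sups hD hBD hB1 x t y 0
    have e1 : Jet.fastF (D.J x) D.s x t y = |Jet.eta (D.J x) x t y| ^ 2 * |Jet.psiJ (D.J x) D.s x y| ^ 2 := by rw [Jet.fastF, sq_abs, sq_abs]
    have hκ' : (D.κ ^ (1 / 2 : ℝ)) ^ 2 = D.κ := by
      rw [← Real.rpow_natCast, ← Real.rpow_mul (by show (0:ℝ) ≤ P.κ; linarith)]; norm_num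
    rw [e1]
    calc |Jet.eta (D.J x) x t y| ^ 2 * |Jet.psiJ (D.J x) D.s x y| ^ 2 ≤ (B * D.κ ^ (1 / 2 : ℝ)) ^ 2 * (B * D.μ) ^ 2 :=
          mul_le_mul (pow_le_pow_left₀ (abs_nonneg _) e0 2) (pow_le_pow_left₀ (abs_nonneg _) p0 2) (by positivity) (by positivity)
      _ = D.fastSup B := by rw [mul_pow, hκ', Datum.fastSup]; ring
  have hΦ : ∀ x t y, |Jet.fastF (D.J x) D.s x t y - 1| ≤ P.Φ c := by
    intro x t y
    have hf0 : 0 ≤ Jet.fastF (D.J x) D.s x t y := by unfold Jet.fastF; positivity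
    have := hfastF x t y
    rw [abs_le]; constructor
    · show -(D.fastSup B + 1) ≤ _; linarith
    · show _ ≤ D.fastSup B + 1; linarith
  -- fixed-time sizes used by several conjuncts
  have iEp : ∀ {t}, t ∈ Icc 0 P.T → ∫ y, ‖D.wp t y‖ ^ 2 ≤ P.Ep c := by
    intro t ht
    refine (Datum.integral_norm_wp_sq_le hD hAmp ht).trans ?_
    show NN * (5 * (2 / radius (Fin 3) * (D.γ₀ + 3 * ∫ y, ‖D.M t y‖) + 3 * H₁ * (Real.sqrt 3 / D.σ))) ≤
      NN * (5 * (2 / radius (Fin 3) * (P.γ₀ + 3 * (1 * P.δ)) + 3 * H₁ * (Real.sqrt 3 / P.σ)))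
    have hr := radius_pos Datum.hd3 (d := Fin 3)
    have hN' := one_le_NN
    have hMδ' : ∫ y, ‖D.M t y‖ ≤ 1 * P.δ := by rw [one_mul]; exact hNδ t ht
    have : D.γ₀ = P.γ₀ := rfl
    rw [this]
    have : (D.σ : ℝ) = P.σ := rfl
    rw [this]
    gcongr
  have iSc : ∀ {t}, t ∈ Icc 0 P.T → ∀ y, ‖D.wpc t y - D.wp t y‖ ≤ P.Sc c := fun ht y => Datum.norm_wc_le_sup hD hBD hB1 hAmp ht y
  have iLc : ∀ {t}, t ∈ Icc 0 P.T → ∫ y, ‖D.wpc t y - D.wp t y‖ ≤ P.Lc c := fun ht => Datum.integral_norm_wc_le hD hBD hAmp ht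
  have iEX : ∀ {t}, t ∈ Icc 0 P.T → ∫ y, ‖D.X t y‖ ^ 2 ≤ P.EX c := fun ht => Datum.integral_norm_X_sq_le hD hBD hB1 hAmp ht
  have iEζ : ∀ {t}, t ∈ Icc 0 P.T → ∫ y, ‖Torus.gradient (D.zeta t) y‖ ^ 2 ≤ P.Eζ c := fun ht =>
    Datum.integral_norm_gradient_zeta_sq_le hD ht (by show 0 ≤ P.Z c; unfold StepPars.Z; positivity)
      fun i => Datum.eLpNorm_partialDeriv_zeta_le hD hBD hB1 hAmp hC₂' ht i
  have iLp : ∀ {t}, t ∈ Icc 0 P.T → ∫ y, ‖D.wp t y‖ ≤ P.Lp c := fun ht => Datum.integral_norm_wp_le hD hBD hAmp ht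
  have iEr : ∀ {t}, t ∈ Icc 0 P.T → ∫ y, ‖D.wrW s t y‖ ^ 2 ≤ P.Er c := fun ht =>
    Datum.integral_norm_wrW_sq_le hD hsD ht (hs01 _ ht) (iSc ht) (iLc ht) (iEX ht) (iEζ ht)
  have e1 : Real.sqrt (3 * (P.Sc c * P.Lc c + P.EX c + P.Eζ c)) = Real.sqrt (P.Er c) := rfl
  have e2 : (3 : ℝ) * (P.Sc c * P.Lc c + P.EX c + P.Eζ c) = P.Er c := rfl
  have hS'0 : 0 ≤ S' := (abs_nonneg _).trans (hS' 0 ⟨le_rfl, hT.le⟩)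
  -- the main estimates, one conjunct at a time
  refine ⟨fun t y => v t y + D.wW s t y, _, _, hnew, ?_, ?_, ?_, ?_, ?_, ?_, ?_, ?_, ?_, ?_⟩
  · -- zero mean
    intro t ht
    show ∫ y, (v t y + D.wW s t y) = 0
    rw [integral_add (hvS.isSmooth_slice ht).integrable ((Datum.smooth_wW hD hsD).isSmooth_slice ht).integrable]
    have h1 : ∫ y, v t y = 0 := hmean t ht
    have h2 : ∫ y, D.wW s t y = 0 := Datum.hasZeroMean_wW hD hsD ht
    rw [h1, h2, add_zero]
  · -- the L² increment
    intro t ht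
    have h01 := hs01 t ht
    have hswp := Datum.isSmooth_swp hD hsD ht
    have hwr := Datum.isSmooth_wrW hD hsD ht
    have hEp' : ∫ y, ‖s t • D.wp t y‖ ^ 2 ≤ P.Ep c := by
      refine le_trans (integral_mono (hswp.continuous.norm.pow 2).integrable_unitAddTorus
        ((Datum.isSmooth_wp hD ht).continuous.norm.pow 2).integrable_unitAddTorus fun y => ?_) (iEp ht)
      have hs1 := (Datum.weight_le_one hD h01).1
      have : ‖s t • D.wp t y‖ ≤ ‖D.wp t y‖ := by
        rw [norm_smul, Real.norm_eq_abs]; exact (mul_le_mul_of_nonneg_right hs1 (norm_nonneg _)).trans (by rw [one_mul])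
      exact pow_le_pow_left₀ (norm_nonneg _) this 2
    have e : (fun y => v t y + D.wW s t y) - v t = fun y => s t • D.wp t y + D.wrW s t y := by
      funext y; show v t y + D.wW s t y - v t y = s t • D.wp t y + (D.wW s t y - s t • D.wp t y); abel
    rw [e]
    have m2 : AEStronglyMeasurable (fun y => s t • D.wp t y) volume := hswp.continuous.aestronglyMeasurable
    have m3 : AEStronglyMeasurable (D.wrW s t) volume := hwr.continuous.aestronglyMeasurable
    calc eLpNorm (fun y => s t • D.wp t y + D.wrW s t y) 2 volume
        ≤ eLpNorm (fun y => s t • D.wp t y) 2 volume + eLpNorm (D.wrW s t) 2 volume := eLpNorm_add_le m2 m3 (by norm_num)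
      _ ≤ ENNReal.ofReal (Real.sqrt (P.Ep c)) + ENNReal.ofReal (Real.sqrt (P.Er c)) :=
          add_le_add (Torus.eLpNorm_two_le_ofReal_sqrt hswp.continuous hEp') (Torus.eLpNorm_two_le_ofReal_sqrt hwr.continuous (iEr ht))
      _ = ENNReal.ofReal (Real.sqrt (P.Ep c) + Real.sqrt (P.Er c)) := by
          rw [← ENNReal.ofReal_add (Real.sqrt_nonneg _) (Real.sqrt_nonneg _)]
  · -- the L¹ stress bound
    intro t ht
    have h01 := hs01 t ht
    have idW : ∀ i, ∫ y, ‖Torus.partialDeriv i (D.wpc t) y‖ ≤ P.LdW c := fun i => Datum.integral_norm_partialDeriv_wpc_le hD hAmp hBD ht i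
    have idX : ∀ i, ∫ y, ‖Torus.partialDeriv i (D.X t) y‖ ≤ P.LdX c := fun i => Datum.integral_norm_partialDeriv_X_le hD hAmp hBD hB1 ht i
    have iS : ∫ y, ‖D.Sosc t y‖ ≤ P.LS c := (Datum.integral_norm_Sosc_f₂_le hD hAmp hBD ht).1
    have if2 : ∫ y, ‖D.f₂ t y‖ ≤ P.Lf₂ c := (Datum.integral_norm_Sosc_f₂_le hD hAmp hBD ht).2
    have if3 : ∫ y, ‖D.f₃ t y‖ ≤ P.Lf₃ c := Datum.integral_norm_f₃_le hD hAmp ht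
    have if1 : ∫ y, ‖Torus.antidivergence (D.f₁ t) y‖ ≤ P.Lf₁ c :=
      (Datum.integral_norm_antidivergence_f₁_le hD hAmp hBD hB1 (p := 33 / 32) (by norm_num) (by norm_num) hCℛ ht).2
    have iV : ∀ y, ‖v t y‖ ≤ P.V := fun y => hv t ht y
    have iρ : ∀ y, ‖Rc t y‖ ≤ ρc := fun y => hρ t ht y
    have hLdW0 : 0 ≤ P.LdW c := (integral_nonneg fun y => norm_nonneg _).trans (idW 0)
    have hLdX0 : 0 ≤ P.LdX c := (integral_nonneg fun y => norm_nonneg _).trans (idX 0)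
    have h1 := Datum.integral_norm_newStressW_le hD hsD (ν := ν) hRc ht (hvS.isSmooth_slice ht).continuous h01 (hS' t ht) iV iρ (iEp ht) (iLp ht)
      (iSc ht) (iLc ht) (iEX ht) (iEζ ht) idW idX iS if2 if3 if1 hC₁
    rw [e1, e2] at h1
    refine h1.trans ?_
    have hν' : |ν| ≤ 1 := by rw [abs_of_pos hν]; exact hν1
    have hk : 4 * |ν| * (3 * (P.LdW c + P.LdX c)) ≤ 4 * (3 * (P.LdW c + P.LdX c)) := by
      have : 0 ≤ 3 * (P.LdW c + P.LdX c) := by positivity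
      nlinarith [abs_nonneg ν]
    have hpos : 0 ≤ (P.V + 1 / P.T) * (P.V + P.V) * P.ℓ := by positivity
    show _ ≤ 2 * ρc + (2 * (1 * (P.V + 1 / P.T) * (P.V + P.V) * P.ℓ + (2 * (Real.sqrt (P.Ep c) * Real.sqrt (P.Er c)) + P.Er c) + P.LS c) +
      4 * (1 * P.V) * (P.Lp c + P.Lc c + Real.sqrt (P.EX c) + Real.sqrt (P.Eζ c)) + 4 * (3 * (P.LdW c + P.LdX c)) +
      (P.Lf₁ c + C₁ * (2 * (P.Lf₂ c + P.Lf₃ c)))) + S' * (C₁ * (P.Lp c + P.Lc c + 2 * Real.sqrt (P.EX c)))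
    linarith [hk]
  · -- the sup stress bound
    intro t ht y
    have h01 := hs01 t ht
    have hwpc : Torus.IsSmooth (D.wpc t) := (Datum.smooth_wpc hD).isSmooth_slice ht
    have hX : Torus.IsSmooth (D.X t) := (Datum.smooth_X hD).isSmooth_slice ht
    obtain ⟨hs1, -, hs2'⟩ := Datum.weight_le_one hD h01
    have hSd : ∀ i y, ‖Torus.partialDeriv i (D.wW' s t) y‖ ≤ P.Sd c := by
      intro i y
      have h1' : Torus.IsSmooth (fun z => s t • D.wpc t z) := hwpc.smul (s t)
      have h2' : Torus.IsSmooth (fun z => (s t) ^ 2 • D.X t z) := hX.smul ((s t) ^ 2)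
      have e0 : Torus.partialDeriv i (D.wW' s t) y = Torus.partialDeriv i (fun z => s t • D.wpc t z) y + Torus.partialDeriv i (fun z => (s t) ^ 2 • D.X t z) y :=
        ((h1'.hasDerivAt_line_zero i y).add (h2'.hasDerivAt_line_zero i y)).deriv
      rw [e0, show (fun z => s t • D.wpc t z) = s t • D.wpc t from rfl, Torus.partialDeriv_const_smul (hwpc.isContDiff (by simp)),
        show (fun z => (s t) ^ 2 • D.X t z) = (s t) ^ 2 • D.X t from rfl, Torus.partialDeriv_const_smul (hX.isContDiff (by simp))]
      refine (norm_add_le _ _).trans (add_le_add ?_ ?_)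
      · rw [Pi.smul_apply, norm_smul, Real.norm_eq_abs]
        exact (mul_le_mul_of_nonneg_right hs1 (norm_nonneg _)).trans (by rw [one_mul]; exact Datum.norm_partialDeriv_wpc_le_sup hD hAmp hBD hB1 ht i y)
      · rw [Pi.smul_apply, norm_smul, Real.norm_eq_abs]
        exact (mul_le_mul_of_nonneg_right hs2' (norm_nonneg _)).trans (by rw [one_mul]; exact Datum.norm_partialDeriv_X_le_sup hD hAmp hBD hB1 ht i y)
    have hpieces := fun z => Datum.norm_f₂_f₃_Sosc_le hD hAmp (K₁ := K₁) hK₁ ht (fun x z => hΦ x t z) z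
    have hSf : ∀ z, ‖D.f₁ t z‖ + ‖D.f₂ t z‖ + ‖D.f₃ t z‖ + ‖D.f₄ t‖ ≤ P.Sf c := by
      intro z
      have b1 : ‖D.f₁ t z‖ ≤ D.dtwpcSup A₀ A₁ A₂ B := Datum.norm_timeDerivWithin_wpc_le_sup hD hAmp hBD hB1 ht z
      have b4 : ‖D.f₄ t‖ ≤ P.Lf₂ c + P.Lf₃ c :=
        (Datum.norm_f₄_le hD hRc ht).trans (add_le_add (Datum.integral_norm_Sosc_f₂_le hD hAmp hBD ht).2 (Datum.integral_norm_f₃_le hD hAmp ht))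
      calc _ ≤ D.dtwpcSup A₀ A₁ A₂ B + NN * ((2 * 3 + 1) * (27 * H₂) * (3 * ((K₁ : ℝ) * P.Φ c))) +
            NN * (3 * D.mup⁻¹ * (H₁ * (P.Φ c + 1))) + (P.Lf₂ c + P.Lf₃ c) :=
            add_le_add (add_le_add (add_le_add b1 (hpieces z).1) (hpieces z).2.1) b4
        _ = P.Sf c := rfl
    have iV : ∀ z, ‖v t z‖ ≤ P.V := fun z => hv t ht z
    have iρ : ∀ z, ‖Rc t z‖ ≤ ρc := fun z => hρ t ht z
    have iSw : ∀ z, ‖D.wW s t z‖ ≤ P.Sw c := fun z => Datum.norm_wW_le_sup hD hAmp hBD hB1 (K := K) hK ht h01 z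
    have iSp : ∀ z, ‖D.wp t z‖ ≤ P.Sp c := fun z => Datum.norm_wp_le_sup hD hBD hB1 hAmp ht z
    have iSX : ∀ z, ‖D.X t z‖ ≤ P.D.XSup (P.A₀ c) c.B := fun z => Datum.norm_X_le_sup hD hBD hB1 hAmp ht z
    have iSS : ∀ z, ‖D.Sosc t z‖ ≤ P.SS c := fun z => (hpieces z).2.2
    have h1 := Datum.norm_newStressW_le_sup hD hsD (ν := ν) hRc ht h01 (hS' t ht) iV iρ iSw iSp (iSc ht) iSX hSd iSS hSf
      (fun g hg C hC hb z => hKℛ g hg C hC hb z) y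
    refine h1.trans ?_
    have hν' : |ν| ≤ 1 := by rw [abs_of_pos hν]; exact hν1
    have hSd0 : 0 ≤ P.Sd c := (norm_nonneg _).trans (hSd 0 y)
    have hk : 4 * |ν| * (3 * P.Sd c) ≤ 4 * (3 * P.Sd c) := by nlinarith [abs_nonneg ν]
    have hpos : 0 ≤ 1 * (P.V + 1 / P.T) * (P.V + P.V) * P.ℓ := by positivity
    show _ ≤ 2 * ρc + (2 * (1 * (P.V + 1 / P.T) * (P.V + P.V) * P.ℓ + (2 * (P.Sp c * (P.Sw c + P.Sp c)) + (P.Sw c + P.Sp c) ^ 2) + P.SS c) +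
      4 * (1 * P.V * P.Sw c) + 4 * (3 * P.Sd c) + Kℛ * P.Sf c) + Kℛ * (S' * (P.Sp c + P.Sc c + 2 * P.D.XSup (P.A₀ c) c.B))
    rw [one_mul]
    have : Kℛ * (P.Sf c + S' * (P.Sp c + P.Sc c + 2 * P.D.XSup (P.A₀ c) c.B)) = Kℛ * P.Sf c + Kℛ * (S' * (P.Sp c + P.Sc c + 2 * P.D.XSup (P.A₀ c) c.B)) := by
      ring
    linarith [hk]
  · -- sup of v'
    intro t ht y
    show ‖v t y + D.wW s t y‖ ≤ 1 * P.V + P.Sw c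
    rw [one_mul]
    exact (norm_add_le _ _).trans (add_le_add (hv t ht y) (Datum.norm_wW_le_sup hD hAmp hBD hB1 (K := K) hK ht (hs01 t ht) y))
  · -- sup of ∂ᵢ v'
    intro t ht y i
    have e : Torus.partialDeriv i (fun y => v t y + D.wW s t y) y = Torus.partialDeriv i (v t) y + Torus.partialDeriv i (D.wW s t) y :=
      (((hvS.isSmooth_slice ht).hasDerivAt_line_zero i y).add (((Datum.smooth_wW hD hsD).isSmooth_slice ht).hasDerivAt_line_zero i y)).deriv
    rw [e]
    have hfin := add_le_add (hdv i t ht y) (Datum.norm_partialDeriv_wW_le_sup hD hAmp hBD hB1 hCψD (K := K) hK ht (hs01 t ht) i y)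
    refine (norm_add_le _ _).trans (hfin.trans ?_)
    show P.V + D.dwSup A₀ A₁ A₂ H₁ H₂ B Cψ K ≤ 1 * (P.V + P.V) + D.dwSup A₀ A₁ A₂ H₁ H₂ B Cψ K
    linarith
  · -- sup of ∂ₜ v'
    intro t ht y
    have key := (hvS.hasDerivWithinAt_slice ht y).add ((Datum.smooth_wW hD hsD).hasDerivWithinAt_slice ht y)
    have e : Torus.timeDerivWithin (Icc 0 P.T) (fun t y => v t y + D.wW s t y) t y =
        Torus.timeDerivWithin (Icc 0 P.T) v t y + Torus.timeDerivWithin (Icc 0 P.T) (D.wW s) t y := key.derivWithin (Datum.uniqueDiffOn hD t ht)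
    rw [e]
    have hfin := add_le_add (htv t ht y) (Datum.norm_timeDerivWithin_wW_le_sup hD hAmp hBD hB1 hsD (K := K) (K₁ := K₁) hK hK₁ ht (hs01 t ht) (hS' t ht) y)
    refine (norm_add_le _ _).trans (hfin.trans ?_)
    show P.V + (D.dtwSup A₀ A₁ A₂ H₁ H₂ B K₁ + S' * (2 * D.wSup A₀ A₁ H₁ B K)) ≤
      1 * (P.V + P.V) + D.dtwSup A₀ A₁ A₂ H₁ H₂ B K₁ + S' * (2 * D.wSup A₀ A₁ H₁ B K)
    linarith
  · -- the energy identity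
    intro t ht
    have h1 := Datum.abs_energy_sub_le hD hAmp hsD (v := v) ht (hvS.isSmooth_slice ht).continuous (hs01 t ht) (fun y => hv t ht y) (iEp ht) (iLp ht)
      (iSc ht) (iLc ht) (iEX ht) (iEζ ht)
    rw [e1, e2] at h1
    exact h1
  · -- the pumped energy vs `6γ₀/r`
    intro t ht
    exact Datum.abs_integral_rho_trace_sub_le hD ht
  · -- locality
    intro t ht h0 h0'
    exact Datum.newW_of_weight_eq_zero (D := D) (s := s) ν v Rc h0 h0'

end JetStep

end Literature.Analysis.FluidPDE
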